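import Mathlib
import Literature.NumberTheory.NumberFields.PureCubicClassNumberModThreeProofs
import Literature.NumberTheory.NumberFields.PureCubicGenusDivisorLemmas
import Literature.NumberTheory.NumberFields.UnramifiedCyclicOddDegreeArtinMap
import Literature.NumberTheory.NumberFields.KummerCubeRootUnramified
import Literature.NumberTheory.GaloisRepresentations.UnitsHerbrand
import Literature.NumberTheory.GaloisRepresentations.UnitIdelesHerbrand
import Literature.NumberTheory.NumberFields.PureCubicClassNumberModThree
import Literature.NumberTheory.NumberFields.PureCubicAmbiguousClassDescent
import HarnessLib

/-!
# Honda's two-prime criterion `3 ∣ h(ℚ(∛(pq))) ⟺ ¬(p, q ≡ 2,5 (mod 9))` for `pq ≡ ±1 (mod 9)` — `Honda1971_three_dvd_classNumber_twoPrimes` HOLDS (re-homed proofs)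

**Honda's two-prime criterion, PROOF COMPLETED: for distinct primes `p, q` with `pq ≡ ±1 (mod 9)` and every cubic number
field `K ∋ ∛(pq)`, `3 ∣ h(K) ⟺ ¬(p ≡ 2,5 (mod 9) ∧ q ≡ 2,5 (mod 9))`** (T. Honda, *Pure cubic fields whose class numbers are
multiples of three*, J. Number Theory 3 (1971) 7–12, Theorem, cases (iv)–(v); S. Aouissi, D. C. Mayer, M. C. Ismaili, M. Talbi,
A. Azizi, Period. Math. Hungar. 81 (2020), Thm. 2.3 item (5) with eq. (2.1): for conductor `f = q₁q₂` one has `3 ∤ h_L` iff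
`q_j ≡ 2, 5 (mod 9)`) — the EXACT discharge `Literature.NumberTheory.NumberFields.Honda1971_three_dvd_classNumber_twoPrimes_holds`
of the Literature named fact `Honda1971_three_dvd_classNumber_twoPrimes` (`PureCubicClassNumberModThree.lean`), whose sibling
proof file `PureCubicClassNumberModThreeProofs.lean` (installments 1–9: residues, genus case `p ≡ 1 (mod 3)`, ascent, local
non-norm lemmas, ambient field, Hecke's criterion) left open exactly the two directions closed here.  RE-HOMED into `Literature/`
by the Hodge foundations lane (`lit-hodgefound`, seat p20, generation 37): verbatim DECLARATION-LEVEL ports, in dependency order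
and each with its original module docstring, of the theorem-only parts of `Summits/QuantumAdvantage/QuantumAdvantage/Theorems/
LinnikCubicClassGroupsPureCubicClassNumberHard{Honda88Kummer, StubRamificationCensus, StubZetaNotNorm, StubUnitsNormOne9,
Honda25 (2 declarations), HondaTwoInertSetup (2), Honda88 (1)}.lean`, namespace
`Summit.QuantumAdvantage.QuantumAdvantage.Theorems.LinnikCubicClassGroups` re-rooted as `Literature.NumberTheory.NumberFields.Honda1971`;
the Chevalley/descent machinery is the sibling file `PureCubicAmbiguousClassDescent.lean`.

PROOF AS FORMALISED: (`3 ∤ h` direction, `p ≡ 2`, `q ≡ 5 (mod 9)`) Chevalley's ambiguous-class argument for the cyclic cubic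
`L = K(ζ₃)/F = ℚ(ζ₃)`: no prime of `F` other than those above `p, q` ramifies (relative different, Dedekind species 2 since
`pq ≡ 1 (mod 9)`; Hecke's integral generator at `λ = 1 − ζ₃`), `ζ₃` is not a norm from `L` (local obstruction at the totally
ramified inert prime `p`, `9 ∤ p² − 1`), nine norm-one units modulo `σ`-coboundaries from the unit Herbrand quotient
(`Literature/NumberTheory/GaloisRepresentations/UnitsHerbrand.lean`, Childress Ch. 4 Prop. 5.10; Aouissi et al. §2.1
`#H¹ = 3^U·3` with `U = 1`), invariant ideals principal, hence `3 ∤ h_L`, and `3 ∣ h_K ⟹ 3 ∣ h_L` by the ascent of the sibling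
proofs file; (`3 ∣ h` direction, `p ≡ q ≡ 8 (mod 9)`) `L(∛p) = L(∛q)` is cyclic cubic and unramified at every finite prime
(tame primes by the different, primes above `3` by Hecke's criterion `−p = 1 + λ³w`), so `3 ∣ h(L)` by the tree's Artin map for
unramified cyclic extensions of odd prime degree (`UnramifiedCyclicOddDegreeArtinMap.lean`), and `3 ∣ h(K)` by the Hasse-free
descent; the genus case `p ≡ 1` or `q ≡ 1 (mod 3)` is `Honda1971.three_dvd_classNumber_of_mod_three_eq_one` (sibling proofs
file).  The printed proofs instead read both directions off `h_k = (Q/3)·h_L²` and Chevalley's formula — a deviation of method,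
not of statement.  Theorem-only file: no definition, no new named fact (D-0026); imports Mathlib/Literature only.  Its only
previous proof was the Summits-side `Summit.QuantumAdvantage.QuantumAdvantage.Theorems.LinnikCubicClassGroups.
Honda1971_three_dvd_classNumber_twoPrimes_holds`, which `Literature/` cannot import; the Summits originals stay in place
(transitional duplication).  Nothing here bears on any summit statement.
-/

noncomputable section

/-!
## Part 1 — port of `Summits/QuantumAdvantage/QuantumAdvantage/Theorems/LinnikCubicClassGroupsPureCubicClassNumberHardHonda88Kummer.lean`

# `p ≡ −1 (mod 9)`: the unramified Kummer extension `L(∛p)/L` of `L = ℚ(ζ₃, ∛(pq))` and `3 ∣ h(L)`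

The genus-theoretic half of Honda's criterion (Honda 1971, Theorem)
in the case `p ≡ q ≡ 8 (mod 9)`, over the sextic field `L = K(ζ₃)`:

* `pow_three_ne_natCast_of_ramified` — `X³ − p` has no root in `L`: a root in `F = ℚ(ζ₃)` would
  make `p²` a rational cube; a root outside `F` would make `L = F(∛p)` unramified at the prime
  above `q`, which is totally ramified;
* `three_dvd_classNumber_of_cubeRoot_unramified` — **`3 ∣ h(L)`**: `E = L(∛p) = L(∛q)` is a cyclic
  cubic extension unramified at every finite prime (tame primes by the different `∋ 3∛p², 3∛q²`;
  primes above `3` by Hecke's criterion, since `−p = 1 + λ³w`, `λ = 2ζ₃ + 1`), so the tree's Artin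
  map for unramified cyclic extensions of odd prime degree applies.

## References
* T. Honda, *Pure cubic fields whose class numbers are multiples of three*, J. Number Theory 3
  (1971) 7–12, Theorem. [Honda1971]
* S. Aouissi, D. C. Mayer, M. C. Ismaili, M. Talbi, A. Azizi, *3-rank of ambiguous class groups of
  cubic Kummer extensions*, Period. Math. Hungar. 81 (2020), Thm. 2.3. [AouissiMayerIsmailiTalbiAzizi2020]
* E. Hecke, *Lectures on the Theory of Algebraic Numbers*, GTM 77 (1981), §39 Thm. 119. [Hecke1981]
-/

section Part1

open _root_.NumberField _root_.Polynomial _root_.IsDedekindDomain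

open scoped _root_.Pointwise _root_.NumberField nonZeroDivisors _root_.IntermediateField

namespace Literature.NumberTheory.NumberFields.Honda1971

open Literature.NumberTheory.NumberFields

/-! ### `X³ − p` stays irreducible over `L = ℚ(ζ₃, ∛(pq))` -/

/-- **No cube root of `p` in `L ⊇ F = ℚ(ζ₃)`** when a prime `P ∋ q` (`q ≠ p, 3` prime) of `L` is
totally ramified over `F` (`[L : F] = 3`): if `b³ = p` with `b ∈ F` then `N_{F/ℚ}(b)³ = p²` is a
rational cube; if `b ∉ F` then `L = F(b) = F(∛p)` is unramified at `P ∌ 3p`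
(`isUnramifiedAt_of_cube_eq`), contradicting `e(P|F) = 3`. [cite: AouissiMayerIsmailiTalbiAzizi2020, Thm. 2.3 item (2)/(5) complement: q ≡ 8 (mod 9) (unramified Kummer extension k(∛p)/k, 3 ∣ h_k)] -/
theorem pow_three_ne_natCast_of_ramified {L : Type*} [Field L] [NumberField L]
    (F : IntermediateField ℚ L) (hF2 : Module.finrank ℚ F = 2) (hFL : Module.finrank F L = 3)
    {p q : ℕ} (hp : p.Prime) (hq : q.Prime) (hpq : p ≠ q) (hq3 : q ≠ 3)
    {P : Ideal (𝓞 L)} [hP : P.IsMaximal] (hqP : (q : 𝓞 L) ∈ P)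
    (he : P.ramificationIdx (𝓞 F) = 3) (b : L) : b ^ 3 ≠ (p : L) := by
  classical
  intro hb
  haveI : Fact p.Prime := ⟨hp⟩
  have hP0 : P ≠ ⊥ := Ideal.IsMaximal.ne_bot_of_isIntegral_int P
  let v : HeightOneSpectrum (𝓞 L) := ⟨P, hP.isPrime, hP0⟩
  have h3P : (3 : 𝓞 L) ∉ P := by
    have h := Honda1971.natCast_notMem_of_coprime (K := L)
      ((Nat.coprime_primes hq Nat.prime_three).mpr hq3) v hqP
    exact_mod_cast h
  have hpP : (p : 𝓞 L) ∉ P :=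
    Honda1971.natCast_notMem_of_coprime (K := L) ((Nat.coprime_primes hq hp).mpr hpq.symm) v hqP
  -- `[F(b) : F] ∈ {1, 3}`
  have hint : IsIntegral F b := IsIntegral.of_finite F b
  have htower := Module.finrank_mul_finrank F F⟮b⟯ L
  rw [hFL] at htower
  have hdvd : Module.finrank F F⟮b⟯ ∣ 3 := Dvd.intro _ htower
  rcases (Nat.dvd_prime Nat.prime_three).mp hdvd with h1 | h3
  · -- `b ∈ F`: `N(b)³ = p²` is a rational cube
    obtain ⟨f, hf⟩ := IntermediateField.mem_bot.mp
      (IntermediateField.finrank_adjoin_simple_eq_one_iff.mp h1)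
    have hf3 : f ^ 3 = algebraMap ℚ F (p : ℚ) := by
      apply (algebraMap F L).injective
      rw [map_pow, hf, hb]
      simp
    have hN : (Algebra.norm ℚ f) ^ 3 = ((p ^ 2 : ℕ) : ℚ) := by
      rw [← map_pow, hf3, Algebra.norm_algebraMap, hF2]
      push_cast
      ring
    exact Honda1971.pow_three_ne_of_not_dvd_padicValNat hp (m := p ^ 2)
      (by rw [padicValNat.prime_pow]; decide) _ hN
  · -- `L = F(b)`: then `P ∌ 3p` is unramified over `F`
    have htop : F⟮b⟯ = ⊤ :=
      IntermediateField.eq_of_le_of_finrank_eq le_top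
        (by rw [h3, IntermediateField.finrank_top', hFL])
    have hb' : b ^ 3 = algebraMap (𝓞 F) L (p : 𝓞 F) :=
      hb.trans (map_natCast (algebraMap (𝓞 F) L) p).symm
    have hpP' : algebraMap (𝓞 F) (𝓞 L) (p : 𝓞 F) ∉ P := by
      rw [map_natCast (algebraMap (𝓞 F) (𝓞 L)) p]
      exact hpP
    have hunr := Honda1971.isUnramifiedAt_of_cube_eq hb' htop P h3P hpP'
    have h1 : P.ramificationIdx (𝓞 F) = 1 := Ideal.ramificationIdx_eq_one_iff.mpr hunr
    omega

/-! ### The unramified Kummer extension `L(∛p)/L` for `p ≡ q ≡ −1 (mod 9)` -/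

/-- **`3 ∣ h(L)` from the unramified cyclic cubic extension `L(∛p)/L`.**  Let `L` be a number
field containing a primitive cube root of unity `ζ` and a cube root `θ` of `pq` (`p ≠ q` primes,
`≠ 3`), with `p ≡ −1 (mod 9)` and `X³ − p` irreducible over `L`.  Then `E = L(∛p) = L(∛q)` is a
cyclic cubic extension of `L` unramified at every finite prime: at primes `∌ 3p` by
`𝔇 ∋ 3∛p²`, at primes `∌ 3q` by `𝔇 ∋ 3∛q²` (`isUnramifiedAt_of_cube_eq`), and above `3` because
`−p = 1 + λ³w` with `λ = 2ζ + 1`, `λ² = −3` (`p + 1 = 9k`, `w = −kλ`;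
`isUnramifiedAt_of_one_add_lambda_cubed_of_three_mem`).  The tree's Artin map for unramified
cyclic extensions of odd prime degree (`dvd_classNumber_of_isUnramifiedIn_of_odd_prime_card`)
gives `3 ∣ h(L)`. [cite: AouissiMayerIsmailiTalbiAzizi2020, Thm. 2.3 item (2)/(5) complement: q ≡ 8 (mod 9) (unramified Kummer extension k(∛p)/k, 3 ∣ h_k)] -/
theorem three_dvd_classNumber_of_cubeRoot_unramified (L : Type) [Field L] [NumberField L]
    {ζ : L} (hζ : ζ ^ 2 + ζ + 1 = 0)
    {p q : ℕ} (hp : p.Prime) (hq : q.Prime) (hpq : p ≠ q) (hp9 : p % 9 = 8)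
    {θ : L} (hθ : θ ^ 3 = ((p * q : ℕ) : L)) (hirr : ∀ b : L, b ^ 3 ≠ (p : L)) :
    3 ∣ classNumber L := by
  classical
  -- `ζ` is a primitive cube root of unity
  have hprim : IsPrimitiveRoot ζ 3 := by
    haveI : NeZero ((3 : ℕ) : L) := ⟨by norm_num⟩
    rw [← isRoot_cyclotomic_iff, cyclotomic_three, IsRoot.def]
    simp only [eval_add, eval_pow, eval_X, eval_one]
    exact hζ
  have hζne : (primitiveRoots 3 L).Nonempty := ⟨ζ, (mem_primitiveRoots (by norm_num)).mpr hprim⟩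
  -- the Kummer extension `E = L(∛p)`
  have H : Irreducible (X ^ 3 - C (p : L)) := X_pow_sub_C_irreducible_of_prime Nat.prime_three hirr
  haveI := Fact.mk H
  let E := AdjoinRoot (X ^ 3 - C (p : L))
  haveI hsf := isSplittingField_AdjoinRoot_X_pow_sub_C hζne H
  haveI : IsGalois L E := isGalois_of_isSplittingField_X_pow_sub_C hζne H E
  have hLE : Module.finrank L E = 3 := finrank_of_isSplittingField_X_pow_sub_C hζne H E
  haveI : Module.Finite L E := Polynomial.IsSplittingField.finiteDimensional E (X ^ 3 - C (p : L))
  haveI : NumberField E := NumberField.of_module_finite L E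
  have hcard : Nat.card (E ≃ₐ[L] E) = 3 := by rw [IsGalois.card_aut_eq_finrank, hLE]
  set β : E := AdjoinRoot.root (X ^ 3 - C (p : L)) with hβdef
  have hβ3 : β ^ 3 = (p : E) := by
    rw [hβdef, root_X_pow_sub_C_pow]
    exact map_natCast (AdjoinRoot.of _) p
  have hβ0 : β ≠ 0 := root_X_pow_sub_C_ne_zero (by norm_num) _
  have hgenβ : IntermediateField.adjoin L {β} = ⊤ := by
    rw [eq_top_iff]
    intro z _
    have hz : z ∈ Algebra.adjoin L {β} := by
      rw [hβdef, AdjoinRoot.adjoinRoot_eq_top]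
      trivial
    exact IntermediateField.algebra_adjoin_le_adjoin L {β} hz
  -- the other generator `γ = θ/β`, `γ³ = q`
  set γ : E := algebraMap L E θ * β⁻¹ with hγdef
  have hγ3 : γ ^ 3 = (q : E) := by
    have hp0 : (p : E) ≠ 0 := by exact_mod_cast hp.ne_zero
    have h1 : algebraMap L E ((p * q : ℕ) : L) = (p : E) * (q : E) := by
      rw [map_natCast (algebraMap L E) (p * q), Nat.cast_mul]
    rw [hγdef, mul_pow, ← map_pow, hθ, inv_pow, hβ3, h1, mul_comm (p : E) (q : E), mul_assoc,
      mul_inv_cancel₀ hp0, mul_one]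
  have hgenγ : IntermediateField.adjoin L {γ} = ⊤ := by
    rw [eq_top_iff, ← hgenβ, IntermediateField.adjoin_simple_le_iff]
    have hγmem : γ ∈ IntermediateField.adjoin L {γ} := IntermediateField.mem_adjoin_simple_self L γ
    have hθmem : algebraMap L E θ ∈ IntermediateField.adjoin L {γ} :=
      IntermediateField.algebraMap_mem _ θ
    have hγ0 : γ ≠ 0 := by
      intro h0
      rw [h0, zero_pow three_ne_zero] at hγ3
      exact hq.ne_zero (by exact_mod_cast hγ3.symm)
    have : β = algebraMap L E θ * γ⁻¹ := by
      rw [hγdef, mul_inv, inv_inv, ← mul_assoc, mul_inv_cancel₀, one_mul]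
      intro hθ0
      rw [hθ0, zero_mul] at hγdef
      exact hγ0 hγdef
    rw [this]
    exact mul_mem hθmem (inv_mem hγmem)
  -- `λ = 2ζ + 1`, `λ² = -3`, `-p = 1 + λ³ w`
  let ζO : 𝓞 L := ⟨ζ, hprim.isIntegral (by norm_num)⟩
  have hζO : (ζO : L) = ζ := rfl
  set lam : 𝓞 L := 2 * ζO + 1 with hlamdef
  have hζO3 : ζO ^ 2 + ζO + 1 = 0 := RingOfIntegers.ext (by push_cast; exact hζ)
  have hlam : lam ^ 2 = -3 := by
    rw [hlamdef]
    linear_combination 4 * hζO3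
  obtain ⟨k, hk⟩ : 9 ∣ p + 1 := by omega
  set u : 𝓞 L := -(p : 𝓞 L) with hudef
  set w : 𝓞 L := -(k : 𝓞 L) * lam with hwdef
  have hu : u = 1 + lam ^ 3 * w := by
    have hk' : ((p : 𝓞 L)) + 1 = 9 * k := by exact_mod_cast hk
    rw [hudef, hwdef]
    linear_combination (-1 : 𝓞 L) * hk' + (k : 𝓞 L) * (lam ^ 2 - 3) * hlam
  have hy : (-β) ^ 3 = algebraMap (𝓞 L) E u := by
    have h1 : algebraMap (𝓞 L) E u = -(β ^ 3) := by
      rw [hβ3, hudef, map_neg, map_natCast (algebraMap (𝓞 L) E) p]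
    rw [h1]
    ring
  have hgeny : IntermediateField.adjoin L {-β} = ⊤ := by
    rw [Honda1971.adjoin_neg_eq]
    exact hgenβ
  -- every prime of `E` is unramified over `L`
  have hunrAt : ∀ (Q : Ideal (𝓞 E)) [Q.IsMaximal], Algebra.IsUnramifiedAt (𝓞 L) Q := by
    intro Q hQ
    by_cases h3Q : (3 : 𝓞 E) ∈ Q
    · exact Honda1971.isUnramifiedAt_of_one_add_lambda_cubed_of_three_mem hlam hu hy hgeny Q h3Q
    have hQ0 : Q ≠ ⊥ := Ideal.IsMaximal.ne_bot_of_isIntegral_int Q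
    let vQ : HeightOneSpectrum (𝓞 E) := ⟨Q, hQ.isPrime, hQ0⟩
    by_cases hpQ : (p : 𝓞 E) ∈ Q
    · -- use the generator `γ`, `γ³ = q`, `q ∉ Q`
      have hqQ : (q : 𝓞 E) ∉ Q :=
        Honda1971.natCast_notMem_of_coprime (K := E) ((Nat.coprime_primes hp hq).mpr hpq) vQ hpQ
      have hγ' : γ ^ 3 = algebraMap (𝓞 L) E (q : 𝓞 L) :=
        hγ3.trans (map_natCast (algebraMap (𝓞 L) E) q).symm
      have hqQ' : algebraMap (𝓞 L) (𝓞 E) (q : 𝓞 L) ∉ Q := by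
        rw [map_natCast (algebraMap (𝓞 L) (𝓞 E)) q]
        exact hqQ
      exact Honda1971.isUnramifiedAt_of_cube_eq hγ' hgenγ Q h3Q hqQ'
    · have hβ' : β ^ 3 = algebraMap (𝓞 L) E (p : 𝓞 L) :=
        hβ3.trans (map_natCast (algebraMap (𝓞 L) E) p).symm
      have hpQ' : algebraMap (𝓞 L) (𝓞 E) (p : 𝓞 L) ∉ Q := by
        rw [map_natCast (algebraMap (𝓞 L) (𝓞 E)) p]
        exact hpQ
      exact Honda1971.isUnramifiedAt_of_cube_eq hβ' hgenβ Q h3Q hpQ'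
  have hunr : ∀ v : HeightOneSpectrum (𝓞 L), Algebra.IsUnramifiedIn (𝓞 E) v.asIdeal := by
    intro v
    refine Algebra.isUnramifiedIn_iff_forall_of_isDedekindDomain.mpr fun Q hQ _ => ?_
    haveI := hQ
    exact hunrAt Q
  exact dvd_classNumber_of_isUnramifiedIn_of_odd_prime_card L E Nat.prime_three (by norm_num)
    hcard hunr

end Literature.NumberTheory.NumberFields.Honda1971

end Part1

/-!
## Part 2 — port of `Summits/QuantumAdvantage/QuantumAdvantage/Theorems/LinnikCubicClassGroupsPureCubicClassNumberHardStubRamificationCensus.lean`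

# Ramification census for `L = ℚ(∛(pq), ζ₃) ⊇ F = ℚ(ζ₃)`, `pq ≡ 1 (mod 9)`

For distinct primes `p, q` with `pq ≡ 1 (mod 9)`, a sextic number field `L ∋ θ`, `θ³ = pq`, and a
subfield `F ⊆ L` with `[L:F] = 3` containing a primitive cube root of unity `ζ` (so `[F:ℚ] = 2`,
`F = ℚ(ζ₃)`, `L = F(θ)`): **a prime `𝔔` of `𝓞_L` ramified over `𝓞_F` contains `p` or `q`**
(Dedekind's "second species": `λ = 1 − ζ₃` is unramified in `L/F`).

Proof, entirely through the relative different `𝔇 = 𝔇(𝓞_L/𝓞_F)`: a ramified `𝔔` divides `𝔇`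
(Mathlib `dvd_differentIdeal_iff`), and `𝔇 ∋ g'(θ) = 3θ²` for `g = t³ − pq` since `L = F(θ)`
(Mathlib `aeval_derivative_mem_differentIdeal`, Neukirch III (2.4)); so `3 ∈ 𝔔` or `θ ∈ 𝔔 ∋ pq`.
If `3 ∈ 𝔔`, Hecke's integral generator `z = (θ − 1)/λ`, `λ = ζ − ζ² = √−3`, is a root of the
monic `t³ − λt² − t − w` (`pq = 1 + 9m = 1 + λ³ · λm`) whose derivative at `z` is `≡ −1 (mod 𝔔)`,
contradicting `𝔇 ≤ 𝔔` (Hecke, *Lectures*, §39 Thm. 119, part II of the proof; the tree file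
`Literature/NumberTheory/NumberFields/KummerCubeRootUnramified.lean` runs the same computation
under the extra hypothesis `(u) = 𝔞³`, which is only used away from `3`).
-/

section Part2

open _root_.Polynomial _root_.NumberField _root_.Ideal

open scoped _root_.Pointwise _root_.NumberField _root_.IntermediateField

namespace Literature.NumberTheory.NumberFields.Honda1971

open Literature.NumberTheory.NumberFields

variable {H E : Type*} [Field H] [NumberField H] [Field E] [NumberField E] [Algebra H E]

/-- **Hecke's generator at a prime above `3`.**  Let `H ⊆ E` be number fields, `λ, u, w ∈ 𝓞_H`
with `λ² = −3`, `u = 1 + λ³ w`, and `E = H(y)` with `y³ = u`.  Then no prime `𝔔 ∋ 3` of `𝓞_E`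
contains the relative different `𝔇(𝓞_E/𝓞_H)`: `z = (y − 1)/λ ∈ 𝓞_E` generates `E/H` and is a
root of the monic `t³ − λt² − t − w`, whose derivative at `z` is `≡ −1 (mod 𝔔)`, while it lies in
`𝔇` (Hecke, *Lectures on the Theory of Algebraic Numbers*, §39, proof of Thm. 119, part II;
Neukirch III (2.4)). [cite: AouissiMayerIsmailiTalbiAzizi2020, §2.2 eq. (2.1) (conductor f = pq for d = pq ≡ ±1 (mod 9): Dedekind species 2, λ unramified)] -/
theorem not_differentIdeal_le_of_three_mem {lam u w : 𝓞 H} (hlam : lam ^ 2 = -3)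
    (hu : u = 1 + lam ^ 3 * w) {y : E} (hy : y ^ 3 = algebraMap (𝓞 H) E u)
    (hgen : IntermediateField.adjoin H {y} = ⊤) (Q : Ideal (𝓞 E)) [Q.IsPrime]
    (h3Q : (3 : 𝓞 E) ∈ Q) : ¬ differentIdeal (𝓞 H) (𝓞 E) ≤ Q := by
  -- adapted from Literature/NumberTheory/NumberFields/KummerCubeRootUnramified.lean
  -- (`differentIdeal_eq_top_of_cube_root_one_mod_lambda_cubed`, the part at a prime above `3`)
  classical
  intro hDQ
  have hlam0 : lam ≠ 0 := by
    rintro rfl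
    norm_num at hlam
  have hlamQ : algebraMap (𝓞 H) (𝓞 E) lam ∈ Q := algebraMap_lam_mem_of_three_mem hlam h3Q
  -- the Artin–Schreier generator `z = (y - 1)/λ`
  set lamE : E := algebraMap (𝓞 H) E lam with hlamE
  have hlamE0 : lamE ≠ 0 := by
    rw [hlamE, IsScalarTower.algebraMap_apply (𝓞 H) H E]
    exact (_root_.map_ne_zero _).mpr (RingOfIntegers.coe_ne_zero_iff.mpr hlam0)
  have hlamE2 : lamE ^ 2 = -3 := by
    rw [hlamE, ← map_pow, hlam, map_neg, map_ofNat]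
  have hyE : y ^ 3 = 1 + lamE ^ 3 * algebraMap (𝓞 H) E w := by
    rw [hy, hu, map_add, map_one, map_mul, map_pow]
  set z : E := (y - 1) / lamE with hzdef
  have hz : z ^ 3 - lamE * z ^ 2 - z - algebraMap (𝓞 H) E w = 0 :=
    artinSchreier_cubic_eq_zero hlamE2 hlamE0 hyE
  have hyz : y = 1 + lamE * z := by
    rw [hzdef, mul_div_cancel₀ _ hlamE0, add_sub_cancel]
  -- `z` is integral: a root of the monic `g = t³ − λt² − t − w`
  set g : (𝓞 H)[X] := X ^ 3 - (C lam * X ^ 2 + X + C w) with hgdef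
  have hgmonic : g.Monic := by
    refine (monic_X_pow 3).sub_of_left (lt_of_le_of_lt (degree_add_le _ _) (max_lt
      (lt_of_le_of_lt (degree_add_le _ _) (max_lt ?_ ?_)) ?_))
    · exact (degree_C_mul_X_pow_le 2 lam).trans_lt (by rw [degree_X_pow]; norm_num)
    · rw [degree_X, degree_X_pow]; norm_num
    · exact (degree_C_le).trans_lt (by rw [degree_X_pow]; norm_num)
  have hgz : aeval z g = 0 := by
    rw [hgdef]
    simp only [map_sub, map_add, map_mul, aeval_X_pow, aeval_C, aeval_X]
    linear_combination hz
  have hzint : IsIntegral ℤ z := by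
    have h1 : IsIntegral (𝓞 H) z := ⟨g, hgmonic, by rwa [← aeval_def]⟩
    exact isIntegral_trans z h1
  set Z : 𝓞 E := ⟨z, hzint⟩ with hZdef
  have hZE : algebraMap (𝓞 E) E Z = z := rfl
  -- `E = H(z)`
  have hyint : IsIntegral H y := by
    refine IsIntegral.of_pow (by norm_num : 0 < 3)
      ⟨Polynomial.X - Polynomial.C (algebraMap (𝓞 H) H u), monic_X_sub_C _, ?_⟩
    simp [hy, IsScalarTower.algebraMap_apply (𝓞 H) H E]
  have hgen' : Algebra.adjoin H {algebraMap (𝓞 E) E Z} = ⊤ := by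
    rw [hZE]
    have h1 : Algebra.adjoin H {y} = ⊤ := by
      rw [← IntermediateField.adjoin_simple_toSubalgebra_of_isAlgebraic hyint.isAlgebraic, hgen,
        IntermediateField.top_toSubalgebra]
    apply top_le_iff.mp
    rw [← h1]
    refine Algebra.adjoin_le (Set.singleton_subset_iff.mpr ?_)
    have hz_mem : z ∈ Algebra.adjoin H {z} := Algebra.subset_adjoin rfl
    have hlamH : lamE = algebraMap H E (lam : H) := IsScalarTower.algebraMap_apply (𝓞 H) H E lam
    rw [SetLike.mem_coe, hyz, hlamH]
    exact Subalgebra.add_mem _ (Subalgebra.one_mem _)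
      (Subalgebra.mul_mem _ (Subalgebra.algebraMap_mem _ _) hz_mem)
  -- `g'(Z) ∈ 𝔇`
  have hD := aeval_derivative_mem_differentIdeal (𝓞 H) H E Z hgen'
  have hZint : IsIntegral (𝓞 H) Z := Algebra.IsIntegral.isIntegral Z
  have hgZ : aeval Z g = 0 := by
    apply FaithfulSMul.algebraMap_injective (𝓞 E) E
    rw [← aeval_algebraMap_apply, hZE, hgz, map_zero]
  obtain ⟨h, hh⟩ := minpoly.isIntegrallyClosed_dvd hZint hgZ
  have hgD : aeval Z (derivative g) ∈ differentIdeal (𝓞 H) (𝓞 E) := by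
    have hder : aeval Z (derivative g) =
        aeval Z (derivative (minpoly (𝓞 H) Z)) * aeval Z h := by
      conv_lhs => rw [hh]
      rw [derivative_mul, map_add, map_mul, map_mul, minpoly.aeval, zero_mul, add_zero]
    rw [hder]
    exact Ideal.mul_mem_right _ _ hD
  -- but `g'(Z) = 3Z² − 2λZ − 1 ≡ −1 (mod Q)`
  have hval : aeval Z (derivative g) =
      3 * Z ^ 2 - algebraMap (𝓞 H) (𝓞 E) lam * (2 * Z) - 1 := by
    rw [hgdef]
    simp only [derivative_X_pow, derivative_mul, derivative_C, derivative_X, zero_mul, zero_add,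
      map_sub, map_add, map_mul, aeval_C, aeval_X_pow, Nat.cast_ofNat, map_one, map_zero, map_ofNat]
    ring
  have hmem : 3 * Z ^ 2 - algebraMap (𝓞 H) (𝓞 E) lam * (2 * Z) - 1 ∈ Q := hval ▸ hDQ hgD
  have hmem' : 3 * Z ^ 2 - algebraMap (𝓞 H) (𝓞 E) lam * (2 * Z) ∈ Q :=
    Q.sub_mem (Q.mul_mem_right _ h3Q) (Q.mul_mem_right _ hlamQ)
  have hone : (1 : 𝓞 E) ∈ Q := by
    have := Q.sub_mem hmem' hmem
    rwa [sub_sub_cancel] at this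
  exact ‹Q.IsPrime›.ne_top ((Ideal.eq_top_iff_one Q).mpr hone)

/-- **The derivative of `t³ − a` at a generating cube root lies in the different.**  For
`Θ ∈ 𝓞_E` with `Θ³ = a ∈ 𝓞_H` and `E = H(Θ)`, one has `3Θ² ∈ 𝔇(𝓞_E/𝓞_H)`: `g'(Θ) ∈ 𝔇` for the
minimal polynomial `g` of `Θ` over `𝓞_H` (Neukirch III (2.4); Mathlib
`aeval_derivative_mem_differentIdeal`), and `g ∣ t³ − a`. [cite: AouissiMayerIsmailiTalbiAzizi2020, §2.2 eq. (2.1) (conductor f = pq for d = pq ≡ ±1 (mod 9): Dedekind species 2, λ unramified)] -/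
theorem three_mul_sq_mem_differentIdeal {a : 𝓞 H} (Θ : 𝓞 E)
    (hΘ : Θ ^ 3 = algebraMap (𝓞 H) (𝓞 E) a)
    (hgen : IntermediateField.adjoin H {(Θ : E)} = ⊤) :
    3 * Θ ^ 2 ∈ differentIdeal (𝓞 H) (𝓞 E) := by
  classical
  set g : (𝓞 H)[X] := X ^ 3 - C a with hgdef
  have hgΘ : aeval Θ g = 0 := by
    simp [hgdef, hΘ]
  have hΘint : IsIntegral H (Θ : E) := .of_finite H _
  have hgen' : Algebra.adjoin H {algebraMap (𝓞 E) E Θ} = ⊤ := by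
    rw [← RingOfIntegers.coe_eq_algebraMap,
      ← IntermediateField.adjoin_simple_toSubalgebra_of_isAlgebraic hΘint.isAlgebraic, hgen,
      IntermediateField.top_toSubalgebra]
  have hD := aeval_derivative_mem_differentIdeal (𝓞 H) H E Θ hgen'
  have hZint : IsIntegral (𝓞 H) Θ := Algebra.IsIntegral.isIntegral Θ
  obtain ⟨h, hh⟩ := minpoly.isIntegrallyClosed_dvd hZint hgΘ
  have hder : aeval Θ (derivative g) = aeval Θ (derivative (minpoly (𝓞 H) Θ)) * aeval Θ h := by
    conv_lhs => rw [hh]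
    rw [derivative_mul, map_add, map_mul, map_mul, minpoly.aeval, zero_mul, add_zero]
  have hval : aeval Θ (derivative g) = 3 * Θ ^ 2 := by
    rw [hgdef]
    simp only [derivative_sub, derivative_X_pow, derivative_C, sub_zero, map_mul, aeval_X_pow,
      Nat.cast_ofNat, map_ofNat]
  rw [← hval, hder]
  exact Ideal.mul_mem_right _ _ hD

/-- **Ramification census (Dedekind's second species).**  For distinct primes `p, q` (`≠ 3`) with
`pq ≡ 1 (mod 9)`, a sextic number field `L ∋ θ`, `θ³ = pq`, and a subfield `F` with `[L:F] = 3`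
containing a primitive cube root of unity: every maximal ideal `𝔔` of `𝓞_L` with
`e(𝔔 | 𝔔 ∩ 𝓞_F) ≠ 1` contains `p` or `q`.  (A ramified `𝔔` divides the relative different
`𝔇 ∋ 3θ²`; if `θ ∈ 𝔔` then `pq ∈ 𝔔`; if `3 ∈ 𝔔`, Hecke's generator `(θ − 1)/(ζ − ζ²)`, available
because `pq ≡ 1 (mod 9) = (mod λ⁴)`, shows `𝔔 ∤ 𝔇`.) [cite: AouissiMayerIsmailiTalbiAzizi2020, §2.2 eq. (2.1) (conductor f = pq for d = pq ≡ ±1 (mod 9): Dedekind species 2, λ unramified)] -/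
theorem ramificationCensus :
    ∀ p q : ℕ, p.Prime → q.Prime → p ≠ 3 → q ≠ 3 → p ≠ q → (p * q) % 9 = 1 →
    ∀ (L : Type) [Field L] [NumberField L] (F : IntermediateField ℚ L),
      Module.finrank ℚ L = 6 → Module.finrank F L = 3 →
      (∃ ζ : F, ζ ^ 3 = 1 ∧ ζ ≠ 1) → (∃ θ : L, θ ^ 3 = ((p * q : ℕ) : L)) →
      ∀ (Q : Ideal (𝓞 L)), Q.IsMaximal →
        Q.ramificationIdx (𝓞 F) ≠ 1 →
        ((p : 𝓞 L) ∈ Q ∨ (q : 𝓞 L) ∈ Q) := by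
  intro p q hp hq _ _ hpq hpq9 L _ _ F hL6 hFL hζ hθ Q hQmax hram
  classical
  obtain ⟨ζ, hζ3, hζ1⟩ := hζ
  obtain ⟨θ, hθ⟩ := hθ
  haveI := hQmax.isPrime
  by_contra hcon
  -- `𝔔` is ramified over `𝓞_F`, hence divides the relative different: `𝔇 ≤ 𝔔`
  have hunr : ¬ Algebra.IsUnramifiedAt (𝓞 F) Q := fun h =>
    hram (Ideal.ramificationIdx_eq_one_iff.mpr h)
  have hDQ : differentIdeal (𝓞 F) (𝓞 L) ≤ Q :=
    Ideal.dvd_iff_le.mp (dvd_differentIdeal_iff.mpr hunr)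
  -- `θ ∈ 𝓞_L`
  have hθint : IsIntegral ℤ θ := by
    refine ⟨X ^ 3 - C ((p * q : ℕ) : ℤ), monic_X_pow_sub_C _ (by norm_num), ?_⟩
    simp [hθ]
  set Θ : 𝓞 L := ⟨θ, hθint⟩ with hΘdef
  have hΘL : (Θ : L) = θ := rfl
  have hΘ3 : Θ ^ 3 = algebraMap (𝓞 F) (𝓞 L) ((p * q : ℕ) : 𝓞 F) := by
    rw [map_natCast]
    apply RingOfIntegers.coe_injective
    rw [map_pow, map_natCast, ← RingOfIntegers.coe_eq_algebraMap, hΘL, hθ]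
  -- `[F:ℚ] = 2`, so `F` contains no cube root of `pq` and `L = F(θ)`
  have hFdeg : Module.finrank ℚ F = 2 := by
    have h := Module.finrank_mul_finrank ℚ F L
    rw [hL6, hFL] at h
    omega
  have hnoroot : ∀ x : F, x ^ 3 ≠ ((p * q : ℕ) : F) := by
    intro x hx
    have hint : IsIntegral ℚ x := .of_finite ℚ x
    have h3 : Module.finrank ℚ ℚ⟮x⟯ = 3 := by
      rw [IntermediateField.adjoin.finrank hint, Honda1971.minpoly_eq hp hq hpq hx,
        natDegree_X_pow_sub_C]
    have h := Module.finrank_mul_finrank ℚ ℚ⟮x⟯ F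
    rw [h3, hFdeg] at h
    omega
  have hθF : IsIntegral F θ := .of_finite F θ
  have hdeg : (minpoly F θ).natDegree = 3 := by
    have hdvd : (minpoly F θ).natDegree ∣ 3 := by
      rw [← IntermediateField.adjoin.finrank hθF, ← hFL]
      exact Dvd.intro _ (Module.finrank_mul_finrank F (IntermediateField.adjoin F {θ}) L)
    have hne1 : (minpoly F θ).natDegree ≠ 1 := by
      rw [Ne, minpoly.natDegree_eq_one_iff]
      rintro ⟨x, hx⟩
      refine hnoroot x ?_
      apply (algebraMap F L).injective
      rw [map_pow, hx, hθ, map_natCast]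
    rcases (Nat.dvd_prime Nat.prime_three).mp hdvd with h | h
    · exact absurd h hne1
    · exact h
  have hgen : IntermediateField.adjoin F {θ} = ⊤ := by
    rw [Field.primitive_element_iff_minpoly_natDegree_eq, hdeg, hFL]
  -- `3θ² ∈ 𝔇 ≤ 𝔔`
  have h3Θ : 3 * Θ ^ 2 ∈ Q := hDQ (three_mul_sq_mem_differentIdeal Θ hΘ3 (hΘL ▸ hgen))
  rcases hQmax.isPrime.mem_or_mem h3Θ with h3 | hΘ2
  · -- `3 ∈ 𝔔`: Hecke's generator.  `ζ ∈ 𝓞_F`, `λ = ζ − ζ²`, `λ² = −3`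
    have hζint : IsIntegral ℤ ζ :=
      IsIntegral.of_pow (by norm_num : 0 < 3) (by rw [hζ3]; exact isIntegral_one)
    set ζO : 𝓞 F := ⟨ζ, hζint⟩ with hζOdef
    have hζOF : (ζO : F) = ζ := rfl
    have hζO3 : ζO ^ 3 = 1 := by
      apply RingOfIntegers.coe_injective
      rw [map_pow, map_one, ← RingOfIntegers.coe_eq_algebraMap, hζOF, hζ3]
    have hζO1 : ζO ≠ 1 := by
      intro h
      apply hζ1
      rw [← hζOF, h]
      rfl
    have hζO2 : ζO ^ 2 + ζO + 1 = 0 := by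
      have h : (ζO - 1) * (ζO ^ 2 + ζO + 1) = 0 := by
        linear_combination hζO3
      rcases mul_eq_zero.mp h with h | h
      · exact absurd (sub_eq_zero.mp h) hζO1
      · exact h
    set lam : 𝓞 F := ζO - ζO ^ 2 with hlamdef
    have hlam : lam ^ 2 = -3 := by
      rw [hlamdef]
      linear_combination (ζO - 2) * hζO3 + hζO2
    -- `pq = 1 + 9m = 1 + λ³ (λ m)`
    obtain ⟨m, hm⟩ : ∃ m : ℕ, p * q = 9 * m + 1 := by
      have key := Nat.div_add_mod (p * q) 9
      rw [hpq9] at key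
      exact ⟨_, key.symm⟩
    have hu : ((p * q : ℕ) : 𝓞 F) = 1 + lam ^ 3 * (lam * m) := by
      rw [hm]
      push_cast
      linear_combination (-(m : 𝓞 F) * (lam ^ 2 - 3)) * hlam
    have hy : θ ^ 3 = algebraMap (𝓞 F) L ((p * q : ℕ) : 𝓞 F) := by
      rw [map_natCast, hθ]
    exact not_differentIdeal_le_of_three_mem hlam hu hy hgen Q h3 hDQ
  · -- `θ ∈ 𝔔`, so `pq = θ³ ∈ 𝔔`
    have hΘQ : Θ ∈ Q := hQmax.isPrime.mem_of_pow_mem 2 hΘ2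
    have hpqQ : (p : 𝓞 L) * (q : 𝓞 L) ∈ Q := by
      have h : Θ ^ 3 ∈ Q := Q.pow_mem_of_mem hΘQ 3 (by norm_num)
      rwa [hΘ3, map_natCast, Nat.cast_mul] at h
    exact hcon (hQmax.isPrime.mem_or_mem hpqQ)

end Literature.NumberTheory.NumberFields.Honda1971

end Part2

/-!
## Part 3 — port of `Summits/QuantumAdvantage/QuantumAdvantage/Theorems/LinnikCubicClassGroupsPureCubicClassNumberHardStubZetaNotNorm.lean`

# Local non-norm lemma: `ζ₃` is not a norm at a totally ramified prime with `9 ∤ N𝔭 − 1`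

The decisive arithmetic input of Chevalley's ambiguous-class argument for the cyclic cubic
extension `L = K(ζ₃) ⊇ F = ℚ(ζ₃)` (the `(2,5)`-direction of Honda's criterion) is that `ζ₃` is not
a norm from `L`.  The obstruction is local and generic: let `L/F` be a Galois extension of number
fields of degree `3`, `ζ ∈ 𝓞 F` a primitive cube root of unity, and `P` a maximal ideal of `𝓞 L`
totally ramified over `𝔭 = P ∩ 𝓞 F` (`e(P|𝔭) = 3`, hence `f(P|𝔭) = 1` and the inertia group of
`P` is all of `Gal(L/F)`, i.e. every `σ` acts trivially on `𝓞 L ⁄ P`).  If `3 ∉ 𝔭` and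
`9 ∤ N𝔭 − 1` then no `x ∈ L` has `N_{L/F}(x) = ζ`: such an `x` is a `P`-adic unit
(`v_P ∘ N = 3 v_P`), so `x = n/d` with `d ∉ P`, and `N(y) ≡ y³ (mod P)` for `y ∈ 𝓞 L` gives
`ζ ≡ (n/d)³` in the residue field `𝓞 L ⁄ P ≅ 𝓞 F ⁄ 𝔭`; but `ζ mod P` has order `3` (`3 ∉ P`),
so `n/d` has order `9` and `9 ∣ #(𝓞 F ⁄ 𝔭) − 1`.

The valuation bookkeeping (`valuation_eq_one_of_norm_eq_unit`) is the tree's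
`Literature.NumberTheory.NumberFields.Honda1971`; here we replace its concrete residue-field
hypotheses (`#(𝓞 L ⁄ P) = p^f`, `p ≡ 2, 5 (mod 9)`) by the abstract ones of the skeleton.
-/

section Part3

open _root_.NumberField _root_.IsDedekindDomain

open scoped _root_.Pointwise _root_.NumberField

namespace Literature.NumberTheory.NumberFields.Honda1971

open Literature.NumberTheory.NumberFields Literature.NumberTheory.NumberFields.Honda1971

/-- A root `ω` of `X² + X + 1` keeps multiplicative order `3` modulo every prime ideal `P` not
containing `3`: `ω ≡ 1 (mod P)` would give `3ω = (ω² + ω + 1) − (ω − 1)² ∈ P`, and `ω` is a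
unit. (Variant of the tree's `Honda1971.orderOf_mk_eq_three` with the hypothesis `3 ∉ P` in
place of a rational prime `p ∈ P` coprime to `3`.) [cite: AouissiMayerIsmailiTalbiAzizi2020, §2.1 (unit norm index 3^U: ζ₃ is not a relative norm — local obstruction at a totally ramified prime)] -/
theorem orderOf_mk_eq_three_of_notMem {R : Type*} [CommRing R] {ω : R}
    (hω : ω ^ 2 + ω + 1 = 0) (P : Ideal R) [hP : P.IsPrime] (h3 : (3 : R) ∉ P) :
    orderOf (Ideal.Quotient.mk P ω) = 3 := by
  have hω3 : ω ^ 3 = 1 := by linear_combination (ω - 1) * hω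
  refine orderOf_eq_prime ?_ ?_
  · rw [← map_pow, hω3, map_one]
  · intro h1
    have hmem : ω - 1 ∈ P := by
      rw [← Ideal.Quotient.eq, h1, map_one]
    have h3ω : (3 : R) * ω ∈ P := by
      have h : (3 : R) * ω = (ω ^ 2 + ω + 1) - (ω - 1) * (ω - 1) := by ring
      rw [h, hω, zero_sub]
      exact P.neg_mem (P.mul_mem_left (ω - 1) hmem)
    have hωP : ω ∉ P := fun h => hP.ne_top ((Ideal.eq_top_iff_one _).mpr (by
      have h' : ω ^ 3 ∈ P := P.pow_mem_of_mem h 3 (by norm_num)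
      rwa [hω3] at h'))
    exact h3 ((hP.mem_or_mem h3ω).resolve_right hωP)

/-- In a finite field, an element of order `3` which is a cube `c³` forces `c` to have order `9`,
hence `9 ∣ #K − 1 = #Kˣ`. [cite: AouissiMayerIsmailiTalbiAzizi2020, §2.1 (unit norm index 3^U: ζ₃ is not a relative norm — local obstruction at a totally ramified prime)] -/
theorem nine_dvd_card_sub_one_of_pow_three_eq {K : Type*} [Field K] [Fintype K] {ω : K}
    (hω : orderOf ω = 3) {c : K} (hc : c ^ 3 = ω) : 9 ∣ Fintype.card K - 1 := by
  classical
  have hω1 : ω ≠ 1 := by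
    rintro rfl
    rw [orderOf_one] at hω
    omega
  have hc0 : c ≠ 0 := by
    rintro rfl
    rw [zero_pow three_ne_zero] at hc
    have h := pow_orderOf_eq_one ω
    rw [hω, ← hc, zero_pow three_ne_zero] at h
    exact zero_ne_one h
  -- `c` has order `9 = 3²`
  have hc9 : orderOf c = 9 := by
    have h := orderOf_eq_prime_pow (p := 3) (n := 1) (x := c)
      (by rw [pow_one, hc]; exact hω1)
      (by rw [show 3 ^ (1 + 1) = 3 * 3 by norm_num, pow_mul, hc, ← hω, pow_orderOf_eq_one])
    rw [h]
    norm_num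
  -- hence `9 ∣ #Kˣ = #K - 1`
  have hu : orderOf (Units.mk0 c hc0) = 9 := by
    rw [← orderOf_units, Units.val_mk0, hc9]
  have h := orderOf_dvd_card (x := Units.mk0 c hc0)
  rwa [hu, Fintype.card_units] at h

/-- **Total ramification means the inertia group is everything.**  For `L/F` Galois of degree `3`
and a maximal ideal `P` of `𝓞 L` with `e(P | P ∩ 𝓞 F) = 3`, the inertia group of `P` has order
`3 = #Gal(L/F)`, so every `σ ∈ Gal(L/F)` acts trivially modulo `P`. [cite: AouissiMayerIsmailiTalbiAzizi2020, §2.1 (unit norm index 3^U: ζ₃ is not a relative norm — local obstruction at a totally ramified prime)] -/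
theorem smul_sub_mem_of_ramificationIdx_eq_three {F L : Type*} [Field F] [NumberField F]
    [Field L] [NumberField L] [Algebra F L] [IsGalois F L] (h3 : Module.finrank F L = 3)
    (P : Ideal (𝓞 L)) [P.IsMaximal] (he : P.ramificationIdx (𝓞 F) = 3)
    (σ : L ≃ₐ[F] L) (x : 𝓞 L) : σ • x - x ∈ P := by
  have hcard : Nat.card (P.inertia (L ≃ₐ[F] L)) = Nat.card (L ≃ₐ[F] L) := by
    rw [card_inertia_eq_ramificationIdx L (L ≃ₐ[F] L) F P, he, IsGalois.card_aut_eq_finrank, h3]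
  have htop : P.inertia (L ≃ₐ[F] L) = ⊤ := Subgroup.eq_top_of_card_eq _ hcard
  have hσ : σ ∈ P.inertia (L ≃ₐ[F] L) := htop ▸ Subgroup.mem_top σ
  exact hσ x

/-- **Total ramification means residue degree one.**  For `L/F` Galois of degree `3` and a
maximal ideal `P` of `𝓞 L` with `e(P | 𝔭) = 3`, `𝔭 = P ∩ 𝓞 F`, the fundamental identity
`g · e · f = 3` forces `f(P|𝔭) = 1`, i.e. `#(𝓞 L ⁄ P) = #(𝓞 F ⁄ 𝔭)`. [cite: AouissiMayerIsmailiTalbiAzizi2020, §2.1 (unit norm index 3^U: ζ₃ is not a relative norm — local obstruction at a totally ramified prime)] -/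
theorem card_quot_eq_of_ramificationIdx_eq_three {F L : Type*} [Field F] [NumberField F]
    [Field L] [NumberField L] [Algebra F L] [IsGalois F L] (h3 : Module.finrank F L = 3)
    (P : Ideal (𝓞 L)) [P.IsMaximal] (he : P.ramificationIdx (𝓞 F) = 3) :
    Nat.card (𝓞 L ⧸ P) = Nat.card (𝓞 F ⧸ P.under (𝓞 F)) := by
  classical
  haveI : (P.under (𝓞 F)).IsMaximal := Ideal.IsMaximal.under (𝓞 F) P
  have h := Ideal.ncard_primesOver_mul_ramificationIdxIn_mul_inertiaDegIn (P.under (𝓞 F)) (𝓞 L)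
    (L ≃ₐ[F] L)
  rw [IsGalois.card_aut_eq_finrank, h3,
    Ideal.ramificationIdxIn_eq_ramificationIdx (P.under (𝓞 F)) P (L ≃ₐ[F] L), he,
    Ideal.inertiaDegIn_eq_inertiaDeg (P.under (𝓞 F)) P (L ≃ₐ[F] L)] at h
  -- `g · (3 · f) = 3` forces `f = 1`
  have hf : P.inertiaDeg (𝓞 F) = 1 := by
    have h' : ((P.under (𝓞 F)).primesOver (𝓞 L)).ncard * P.inertiaDeg (𝓞 F) = 1 := by
      have h'' : 3 * (((P.under (𝓞 F)).primesOver (𝓞 L)).ncard * P.inertiaDeg (𝓞 F)) = 3 * 1 := by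
        rw [mul_one, ← mul_left_comm, h]
      exact Nat.eq_of_mul_eq_mul_left (by norm_num) h''
    exact Nat.eq_one_of_mul_eq_one_left h'
  have hc := Ideal.cardQuot_pow_inertiaDeg (P.under (𝓞 F)) P
  rw [hf, pow_one, Submodule.cardQuot_apply, Submodule.cardQuot_apply] at hc
  exact hc.symm

/-- **LOCAL NON-NORM**: in a Galois cubic extension `L/F` of
number fields, if a maximal ideal `P` of `𝓞 L` is totally ramified over `𝔭 = P ∩ 𝓞 F`
(`e = 3`), `3 ∉ 𝔭` and `9 ∤ N𝔭 − 1`, then a primitive cube root of unity `ζ ∈ 𝓞 F` is not a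
norm from `L`.  (If `N x = ζ` then `x` is a `P`-unit, `x = n/d` with `d ∉ P`; as `Gal(L/F)` acts
trivially modulo `P`, `N y ≡ y³ (mod P)`, so `ζ ≡ (n/d)³` in `𝓞 L ⁄ P ≅ 𝓞 F ⁄ 𝔭`, where `ζ`
has order `3`: an element of order `9` in a group of order `N𝔭 − 1`.)  The hypothesis that `P³`
is principal from `F` is not used. [cite: AouissiMayerIsmailiTalbiAzizi2020, §2.1 (unit norm index 3^U: ζ₃ is not a relative norm — local obstruction at a totally ramified prime)] -/
theorem zetaNotNorm :
    ∀ (F L : Type) [Field F] [NumberField F] [Field L] [NumberField L] [Algebra F L]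
      [IsGalois F L], Module.finrank F L = 3 →
      ∀ (ζ : 𝓞 F), (ζ : F) ^ 3 = 1 → (ζ : F) ≠ 1 →
      ∀ (P : Ideal (𝓞 L)), P.IsMaximal →
        P.ramificationIdx (𝓞 F) = 3 →
        (∃ t : 𝓞 F, Ideal.span {algebraMap (𝓞 F) (𝓞 L) t} = P ^ 3) →
        (3 : 𝓞 F) ∉ P.under (𝓞 F) →
        ¬ 9 ∣ Nat.card ((𝓞 F) ⧸ P.under (𝓞 F)) - 1 →
        ∀ x : L, Algebra.norm F x ≠ (ζ : F) := by
  intro F L _ _ _ _ _ _ h3 ζ hζ3 hζ1 P hP he _ h3P h9 x hx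
  classical
  -- `ζ² + ζ + 1 = 0` in `𝓞 F`, and its image `ζL ∈ 𝓞 L`
  have hζ : ζ ^ 2 + ζ + 1 = 0 := by
    apply RingOfIntegers.ext
    have h : ((ζ : F) - 1) * ((ζ : F) ^ 2 + (ζ : F) + 1) = 0 := by
      linear_combination hζ3
    have h' := (mul_eq_zero.mp h).resolve_left (sub_ne_zero.mpr hζ1)
    simpa using h'
  let ζL : 𝓞 L := algebraMap (𝓞 F) (𝓞 L) ζ
  have hζL : ζL ^ 2 + ζL + 1 = 0 := by
    have h := congrArg (algebraMap (𝓞 F) (𝓞 L)) hζ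
    rwa [map_add, map_add, map_pow, map_one, map_zero] at h
  have hζLu : IsUnit ζL :=
    isUnit_iff_exists_inv.mpr ⟨-ζL - 1, by linear_combination (-1 : 𝓞 L) * hζL⟩
  have hcoeζ : algebraMap F L (ζ : F) = ((ζL : 𝓞 L) : L) :=
    (IsScalarTower.algebraMap_apply (𝓞 F) F L ζ).symm.trans
      (IsScalarTower.algebraMap_apply (𝓞 F) (𝓞 L) L ζ)
  -- the prime `P` as a height-one prime; `Gal(L/F)` acts trivially modulo `P`
  haveI := hP
  have hP0 : P ≠ ⊥ := Ideal.IsMaximal.ne_bot_of_isIntegral_int P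
  let v : HeightOneSpectrum (𝓞 L) := ⟨P, hP.isPrime, hP0⟩
  have hinert : ∀ (σ : L ≃ₐ[F] L) (y : 𝓞 L), σ • y - y ∈ v.asIdeal :=
    smul_sub_mem_of_ramificationIdx_eq_three h3 P he
  -- `x` is a `P`-unit, so `x = n / d` with `d ∉ P`
  have hv1 : v.valuation L x = 1 :=
    valuation_eq_one_of_norm_eq_unit v hinert hζLu (by rw [hx, hcoeζ])
  obtain ⟨n, d, hnd⟩ := v.exists_primeCompl_mul_eq_of_integer x hv1.le
  -- norms: `ζ · N(d) = N(n)`, written in `𝓞 L` as products of conjugates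
  have hN : algebraMap F L (ζ : F) * algebraMap F L (Algebra.norm F (algebraMap (𝓞 L) L d)) =
      algebraMap F L (Algebra.norm F (algebraMap (𝓞 L) L n)) := by
    rw [← map_mul, ← hx, ← map_mul, hnd]
  rw [Algebra.norm_eq_prod_automorphisms, Algebra.norm_eq_prod_automorphisms, hcoeζ] at hN
  have hN' : ζL * ∏ σ : L ≃ₐ[F] L, σ • (d : 𝓞 L) = ∏ σ : L ≃ₐ[F] L, σ • n := by
    apply FaithfulSMul.algebraMap_injective (𝓞 L) L
    rw [map_mul, map_prod, map_prod]
    exact hN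
  -- reduce modulo `P`: every `σ` acts trivially
  have hmk : ∀ (σ : L ≃ₐ[F] L) (r : 𝓞 L),
      Ideal.Quotient.mk v.asIdeal (σ • r) = Ideal.Quotient.mk v.asIdeal r :=
    fun σ r => Ideal.Quotient.eq.mpr (hinert σ r)
  have hG : Fintype.card (L ≃ₐ[F] L) = 3 := by
    rw [Fintype.card_eq_nat_card, IsGalois.card_aut_eq_finrank, h3]
  have hq := congrArg (Ideal.Quotient.mk v.asIdeal) hN'
  simp only [map_mul, map_prod, hmk, Finset.prod_const, Finset.card_univ, hG] at hq
  -- in the finite residue field `𝓞 L ⧸ P`, `ζ = (n/d)³` with `ζ` of order `3`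
  haveI : Finite (𝓞 L ⧸ v.asIdeal) := Ideal.finiteQuotientOfFreeOfNeBot P hP0
  letI : Fintype (𝓞 L ⧸ v.asIdeal) := Fintype.ofFinite _
  letI : Field (𝓞 L ⧸ v.asIdeal) := Ideal.Quotient.field v.asIdeal
  have hd : Ideal.Quotient.mk v.asIdeal (d : 𝓞 L) ≠ 0 := by
    rw [Ne, Ideal.Quotient.eq_zero_iff_mem]
    exact d.2
  have h3L : (3 : 𝓞 L) ∉ v.asIdeal := fun h =>
    h3P (by rw [Ideal.mem_comap, map_ofNat]; exact h)
  have hω : orderOf (Ideal.Quotient.mk v.asIdeal ζL) = 3 :=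
    orderOf_mk_eq_three_of_notMem hζL _ h3L
  have h9' := nine_dvd_card_sub_one_of_pow_three_eq hω
    (c := Ideal.Quotient.mk v.asIdeal n * (Ideal.Quotient.mk v.asIdeal (d : 𝓞 L))⁻¹)
    (by rw [mul_pow, ← hq, inv_pow, mul_inv_cancel_right₀ (pow_ne_zero 3 hd)])
  rw [Fintype.card_eq_nat_card] at h9'
  exact h9 (card_quot_eq_of_ramificationIdx_eq_three h3 P he ▸ h9')

end Literature.NumberTheory.NumberFields.Honda1971

end Part3

/-!
## Part 4 — port of `Summits/QuantumAdvantage/QuantumAdvantage/Theorems/LinnikCubicClassGroupsPureCubicClassNumberHardStubUnitsNormOne9.lean`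

# Nine norm-one units modulo `σ`-coboundaries in a cyclic cubic extension of a totally complex field

For a cyclic cubic extension of number fields `L/F` with `Gal(L/F) = ⟨σ⟩`, `F` totally complex,
and a unit `u ∈ 𝓞_Fˣ` which is not the norm of a unit of `L` and such that every unit of `F` is
`uⁱ v³`: there are nine units of `L` of relative norm `1`, pairwise inequivalent modulo the
`σ`-coboundaries `σ(η)/η` of units, i.e. `#Ĥ⁻¹(⟨σ⟩, 𝓞_Lˣ) ≥ 9`.

This is the unit-cohomology input of Chevalley's ambiguous class argument, obtained from the
tree's unit Herbrand quotient `MinkowskiUnit.card_mul_h0_unitsE_eq` (Childress, *Class Field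
Theory*, Ch. 4 §5 Prop. 5.10): `#G · #Ĥ⁰(G, 𝓞_Lˣ) = 2^a · #Ĥ⁻¹(G, 𝓞_Lˣ)` with `#G = 3`,
`2^a = archFactor F L = 1` (all infinite places of `F` are complex, hence unramified in `L`:
trivial stabilisers) and `#Ĥ⁰ = [𝓞_Fˣ : N(𝓞_Lˣ)] = 3` (the `σ`-fixed units of `L` are the units
of `F`; the norm subgroup has the three cosets of `1, u, u²`), so `#Ĥ⁻¹ = 9`; unfolding
`Ĥ⁻¹ = {norm-one units}/{σ(η)/η}` gives nine coset representatives.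
-/

section Part4

open _root_.NumberField

open scoped _root_.Pointwise _root_.NumberField

namespace Literature.NumberTheory.NumberFields.Honda1971

open Literature.NumberTheory.GaloisRepresentations
open Literature.NumberTheory.GaloisRepresentations.MinkowskiUnit

universe u

/-! ### Pure group theory: a subgroup of index `3` -/

/-- In a commutative group, a subgroup `N` with `u ∉ N`, containing all cubes, and such that every
element is `uⁱ v³`, has index `3` (the quotient is cyclic of order `3` generated by `u`).
[cite: AouissiMayerIsmailiTalbiAzizi2020, §2.1 eq. for #H¹(G,E_k) = #H⁰(G,E_k)·[k:k₀] (Herbrand quotient of E_k; nine norm-one units when U = 1)] -/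
theorem index_eq_three_of_cube {M : Type*} [CommGroup M] {N : Subgroup M} {u : M} (hu : u ∉ N)
    (hcube : ∀ v : M, v ^ 3 ∈ N) (hgen : ∀ w : M, ∃ i : ℕ, ∃ v : M, w = u ^ i * v ^ 3) :
    N.index = 3 := by
  have hq3 : ((u : M ⧸ N)) ^ 3 = 1 := by
    rw [← QuotientGroup.mk_pow, QuotientGroup.eq_one_iff]
    exact hcube u
  have hq1 : (u : M ⧸ N) ≠ 1 := fun h => hu ((QuotientGroup.eq_one_iff u).mp h)
  have hord : orderOf (u : M ⧸ N) = 3 := orderOf_eq_prime hq3 hq1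
  have hall : ∀ x : M ⧸ N, x ∈ Subgroup.zpowers (u : M ⧸ N) := by
    intro x
    obtain ⟨w, rfl⟩ := QuotientGroup.mk_surjective x
    obtain ⟨i, v, rfl⟩ := hgen w
    rw [QuotientGroup.mk_mul, QuotientGroup.mk_pow, (QuotientGroup.eq_one_iff _).mpr (hcube v),
      mul_one]
    exact Subgroup.npow_mem_zpowers _ _
  rw [Subgroup.index_eq_card, ← orderOf_eq_card_of_forall_mem_zpowers hall, hord]

/-! ### Global units of `L` and of `F` inside `Lˣ` -/

variable {F : Type u} {L : Type u} [Field F] [NumberField F] [Field L] [NumberField L] [Algebra F L]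

/-! The inclusions `𝓞_Lˣ → Lˣ` (with range `unitsE L`) and `𝓞_Fˣ → Lˣ` are
`Units.map (algebraMap (𝓞 L) L : 𝓞 L →* L)` and `Units.map (algebraMap (𝓞 F) L : 𝓞 F →* L)`. -/

omit [NumberField F] [NumberField L] in
/-- Values of `𝓞_Fˣ → Lˣ`. [cite: AouissiMayerIsmailiTalbiAzizi2020, §2.1 eq. for #H¹(G,E_k) = #H⁰(G,E_k)·[k:k₀] (Herbrand quotient of E_k; nine norm-one units when U = 1)] -/
theorem val_unitsMap_base (w : (𝓞 F)ˣ) :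
    ((Units.map (algebraMap (𝓞 F) L : 𝓞 F →* L) w : Lˣ) : L) = algebraMap F L ((w : 𝓞 F) : F) := by
  rw [Units.coe_map, MonoidHom.coe_coe, IsScalarTower.algebraMap_apply (𝓞 F) F L,
    RingOfIntegers.coe_eq_algebraMap]

omit [NumberField F] [NumberField L] in
/-- `𝓞_Fˣ → Lˣ` factors through `𝓞_Lˣ`. [cite: AouissiMayerIsmailiTalbiAzizi2020, §2.1 eq. for #H¹(G,E_k) = #H⁰(G,E_k)·[k:k₀] (Herbrand quotient of E_k; nine norm-one units when U = 1)] -/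
theorem unitsMap_base_eq (w : (𝓞 F)ˣ) :
    Units.map (algebraMap (𝓞 F) L : 𝓞 F →* L) w = Units.map (algebraMap (𝓞 L) L : 𝓞 L →* L)
      (Units.map (algebraMap (𝓞 F) (𝓞 L) : 𝓞 F →* 𝓞 L) w) := by
  ext
  rw [Units.coe_map, MonoidHom.coe_coe, IsScalarTower.algebraMap_apply (𝓞 F) (𝓞 L) L]
  rfl

omit [NumberField F] [NumberField L] in
/-- `𝓞_Fˣ ⊆ 𝓞_Lˣ` inside `Lˣ`. [cite: AouissiMayerIsmailiTalbiAzizi2020, §2.1 eq. for #H¹(G,E_k) = #H⁰(G,E_k)·[k:k₀] (Herbrand quotient of E_k; nine norm-one units when U = 1)] -/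
theorem unitsMap_base_mem_unitsE (w : (𝓞 F)ˣ) :
    Units.map (algebraMap (𝓞 F) L : 𝓞 F →* L) w ∈ unitsE L := by
  rw [unitsMap_base_eq]
  exact ⟨_, rfl⟩

omit [NumberField F] [NumberField L] in
/-- The units of `F` are fixed by `Gal(L/F)`. [cite: AouissiMayerIsmailiTalbiAzizi2020, §2.1 eq. for #H¹(G,E_k) = #H⁰(G,E_k)·[k:k₀] (Herbrand quotient of E_k; nine norm-one units when U = 1)] -/
theorem smul_unitsMap_base (g : L ≃ₐ[F] L) (w : (𝓞 F)ˣ) :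
    g • Units.map (algebraMap (𝓞 F) L : 𝓞 F →* L) w =
      Units.map (algebraMap (𝓞 F) L : 𝓞 F →* L) w := by
  ext
  rw [val_smul, val_unitsMap_base, AlgEquiv.commutes]

/-- The value of the Herbrand norm `N_G a = ∏_g g • a` of `a ∈ Lˣ` is `∏_g g(a)`. [cite: AouissiMayerIsmailiTalbiAzizi2020, §2.1 eq. for #H¹(G,E_k) = #H⁰(G,E_k)·[k:k₀] (Herbrand quotient of E_k; nine norm-one units when U = 1)] -/
theorem val_herbrandNorm (a : Lˣ) :
    ((Herbrand.norm (L ≃ₐ[F] L) a : Lˣ) : L) = ∏ g : L ≃ₐ[F] L, g (a : L) := by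
  rw [Herbrand.norm_apply, Units.coe_prod]
  exact Finset.prod_congr rfl fun g _ => val_smul g a

/-- For global units `x ∈ 𝓞_Lˣ`, `w ∈ 𝓞_Fˣ`: `N_G x = w` in `Lˣ` iff `N_{L/F}(x) = w`
(`N_G = N_{L/F}` on `L`, `Algebra.norm_eq_prod_automorphisms`). [cite: AouissiMayerIsmailiTalbiAzizi2020, §2.1 eq. for #H¹(G,E_k) = #H⁰(G,E_k)·[k:k₀] (Herbrand quotient of E_k; nine norm-one units when U = 1)] -/
theorem herbrandNorm_eq_iff [IsGalois F L] (x : (𝓞 L)ˣ) (w : (𝓞 F)ˣ) :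
    Herbrand.norm (L ≃ₐ[F] L) (Units.map (algebraMap (𝓞 L) L : 𝓞 L →* L) x) =
        Units.map (algebraMap (𝓞 F) L : 𝓞 F →* L) w ↔
      Algebra.norm F ((x : 𝓞 L) : L) = ((w : 𝓞 F) : F) := by
  rw [← Units.val_inj, val_herbrandNorm, val_unitsMap, ← Algebra.norm_eq_prod_automorphisms,
    val_unitsMap_base, (algebraMap F L).injective.eq_iff]

/-- For a global unit `x ∈ 𝓞_Lˣ`: `N_G x = 1` in `Lˣ` iff `N_{L/F}(x) = 1`. [cite: AouissiMayerIsmailiTalbiAzizi2020, §2.1 eq. for #H¹(G,E_k) = #H⁰(G,E_k)·[k:k₀] (Herbrand quotient of E_k; nine norm-one units when U = 1)] -/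
theorem herbrandNorm_eq_one_iff [IsGalois F L] (x : (𝓞 L)ˣ) :
    Herbrand.norm (L ≃ₐ[F] L) (Units.map (algebraMap (𝓞 L) L : 𝓞 L →* L) x) = 1 ↔
      Algebra.norm F ((x : 𝓞 L) : L) = 1 := by
  rw [← map_one (Units.map (algebraMap (𝓞 F) L : 𝓞 F →* L)), herbrandNorm_eq_iff, Units.val_one,
    show ((1 : 𝓞 F) : F) = 1 from map_one _]

/-! ### `Ĥ⁰`: the fixed units are the units of `F` -/

/-- For `Gal(L/F) = ⟨σ⟩`, the `σ`-fixed global units of `L` are the global units of `F`: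
`z0(𝓞_Lˣ) = 𝓞_Fˣ` inside `Lˣ` (a unit of `𝓞_L` lying in `F` is a unit of `𝓞_F`). [cite: AouissiMayerIsmailiTalbiAzizi2020, §2.1 eq. for #H¹(G,E_k) = #H⁰(G,E_k)·[k:k₀] (Herbrand quotient of E_k; nine norm-one units when U = 1)] -/
theorem z0_unitsE_eq_range [IsGalois F L] {σ : L ≃ₐ[F] L}
    (hσ : ∀ τ : L ≃ₐ[F] L, τ ∈ Subgroup.zpowers σ) :
    Herbrand.z0 σ (unitsE L) ⊥ = (Units.map (algebraMap (𝓞 F) L : 𝓞 F →* L)).range := by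
  ext a
  rw [Herbrand.mem_z0_bot]
  constructor
  · rintro ⟨⟨x, rfl⟩, hfix⟩
    have hall : ∀ g : L ≃ₐ[F] L, g ((x : 𝓞 L) : L) = ((x : 𝓞 L) : L) := fun g =>
      congrArg Units.val ((Herbrand.forall_smul_eq_iff hσ).mpr hfix g)
    obtain ⟨y, hy⟩ := (IsGalois.mem_range_algebraMap_iff_fixed ((x : 𝓞 L) : L)).mpr hall
    have hyint : IsIntegral ℤ y := by
      rw [← isIntegral_algebraMap_iff (algebraMap F L).injective, hy]
      exact RingOfIntegers.isIntegral_coe (x : 𝓞 L)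
    obtain ⟨y₀, rfl⟩ : ∃ y₀ : 𝓞 F, (y₀ : F) = y := ⟨⟨y, hyint⟩, rfl⟩
    have hy₀ : algebraMap (𝓞 F) (𝓞 L) y₀ = (x : 𝓞 L) := by
      apply RingOfIntegers.ext
      rw [RingOfIntegers.coe_eq_algebraMap, ← IsScalarTower.algebraMap_apply (𝓞 F) (𝓞 L) L,
        IsScalarTower.algebraMap_apply (𝓞 F) F L, ← RingOfIntegers.coe_eq_algebraMap, hy]
    have hunit : IsUnit y₀ := by
      rw [← isUnit_pow_iff (Module.finrank_pos (R := F) (M := L)).ne',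
        ← RingOfIntegers.norm_algebraMap F y₀, hy₀]
      exact (RingOfIntegers.isUnit_norm_of_isGalois F).mpr (Units.isUnit x)
    refine ⟨hunit.unit, ?_⟩
    rw [unitsMap_base_eq]
    congr 1
    ext
    rw [Units.coe_map, MonoidHom.coe_coe, IsUnit.unit_spec, hy₀]
  · rintro ⟨w, rfl⟩
    exact ⟨unitsMap_base_mem_unitsE w, smul_unitsMap_base σ w⟩

/-- For `Gal(L/F) = ⟨σ⟩`: `#Ĥ⁰(G, 𝓞_Lˣ)` is the index in `𝓞_Fˣ` of the subgroup of norms of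
global units of `L` (pulled back along `𝓞_Fˣ → Lˣ`). [cite: AouissiMayerIsmailiTalbiAzizi2020, §2.1 eq. for #H¹(G,E_k) = #H⁰(G,E_k)·[k:k₀] (Herbrand quotient of E_k; nine norm-one units when U = 1)] -/
theorem h0_unitsE_eq_index [IsGalois F L] {σ : L ≃ₐ[F] L}
    (hσ : ∀ τ : L ≃ₐ[F] L, τ ∈ Subgroup.zpowers σ) :
    Herbrand.h0 σ (unitsE L) ⊥ = (((unitsE L).map (Herbrand.norm (L ≃ₐ[F] L))).comap
      (Units.map (algebraMap (𝓞 F) L : 𝓞 F →* L))).index := by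
  rw [Herbrand.h0_def, Herbrand.b0_bot, z0_unitsE_eq_range hσ, MonoidHom.range_eq_map,
    ← Subgroup.relIndex_comap, Subgroup.relIndex_top_right]

/-- Membership in the pulled-back norm subgroup: `w` is the relative norm of a unit of `L`.
[cite: AouissiMayerIsmailiTalbiAzizi2020, §2.1 eq. for #H¹(G,E_k) = #H⁰(G,E_k)·[k:k₀] (Herbrand quotient of E_k; nine norm-one units when U = 1)] -/
theorem mem_comap_map_norm_iff [IsGalois F L] (w : (𝓞 F)ˣ) :
    w ∈ ((unitsE L).map (Herbrand.norm (L ≃ₐ[F] L))).comap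
        (Units.map (algebraMap (𝓞 F) L : 𝓞 F →* L)) ↔
      ∃ ε : (𝓞 L)ˣ, Algebra.norm F ((ε : 𝓞 L) : L) = ((w : 𝓞 F) : F) := by
  rw [Subgroup.mem_comap, Subgroup.mem_map]
  constructor
  · rintro ⟨_, ⟨ε, rfl⟩, hε⟩
    exact ⟨ε, (herbrandNorm_eq_iff ε w).mp hε⟩
  · rintro ⟨ε, hε⟩
    exact ⟨_, ⟨ε, rfl⟩, (herbrandNorm_eq_iff ε w).mpr hε⟩

/-! ### Nine norm-one units -/

/-- **NINE NORM-ONE UNITS**: for `L/F` cyclic cubic generated by `σ` with `F`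
totally complex, and a unit `u` of `F` that is not the norm of a unit of `L` while every unit of
`F` is `uⁱ v³`, there are nine units of `L` of relative norm `1` pairwise inequivalent modulo
`σ(η)/η`, `η ∈ 𝓞_Lˣ` (i.e. `#Ĥ⁻¹(⟨σ⟩, 𝓞_Lˣ) ≥ 9`).  From the
tree `MinkowskiUnit.card_mul_h0_unitsE_eq` (`3 · #Ĥ⁰ = 2^a · #Ĥ⁻¹`, Childress Prop. 5.10) with
`2^a = archFactor F L = 1` (complex places are unramified: trivial stabilisers) and
`#Ĥ⁰ = [𝓞_Fˣ : N 𝓞_Lˣ] = 3` (cosets `1, u, u²`).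
[cite: AouissiMayerIsmailiTalbiAzizi2020, §2.1 eq. for #H¹(G,E_k) = #H⁰(G,E_k)·[k:k₀] (Herbrand quotient of E_k; nine norm-one units when U = 1)] -/
theorem unitsNormOne9 :
    ∀ (F L : Type) [Field F] [NumberField F] [Field L] [NumberField L] [Algebra F L]
      [IsGalois F L] (σ : L ≃ₐ[F] L), (∀ τ : L ≃ₐ[F] L, τ ∈ Subgroup.zpowers σ) →
      Module.finrank F L = 3 →
      (∀ v : NumberField.InfinitePlace F, v.IsComplex) →
      ∀ u : (𝓞 F)ˣ,
        (∀ ε : (𝓞 L)ˣ, Algebra.norm F (((ε : 𝓞 L) : L)) ≠ ((u : 𝓞 F) : F)) →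
        (∀ w : (𝓞 F)ˣ, ∃ i : ℕ, ∃ v : (𝓞 F)ˣ, w = u ^ i * v ^ 3) →
        (∃ ε : Fin 9 → (𝓞 L)ˣ,
          (∀ i, Algebra.norm F (((ε i : 𝓞 L) : L)) = 1) ∧
          ∀ i j, i ≠ j → ∀ η : (𝓞 L)ˣ,
            (((ε i : 𝓞 L) : L)) * ((η : 𝓞 L) : L) ≠ (((ε j : 𝓞 L) : L)) * σ ((η : 𝓞 L) : L)) := by
  intro F L _ _ _ _ _ _ σ hσ hdeg hcx u hu hgen
  classical
  -- (1) `#G = 3`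
  have hcard : Fintype.card (L ≃ₐ[F] L) = 3 := by
    rw [Fintype.card_eq_nat_card, IsGalois.card_aut_eq_finrank, hdeg]
  -- (2) `archFactor F L = 1`: complex places of `F` are unramified in `L`
  have harch : ArchHerbrand.archFactor F L = 1 := by
    refine Finset.prod_eq_one fun v _ => ?_
    have hw : (ArchHerbrand.placeOver L v).IsUnramified F := by
      rw [NumberField.InfinitePlace.isUnramified_iff]
      refine Or.inr ?_
      rw [show (ArchHerbrand.placeOver L v).comap (algebraMap F L) = v from
        ArchHerbrand.isOver_placeOver v]
      exact hcx v
    exact NumberField.InfinitePlace.isUnramified_iff_card_stabilizer_eq_one.mp hw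
  -- (3) `#Ĥ⁰ = [𝓞_Fˣ : N 𝓞_Lˣ] = 3`
  have hcube : ∀ v : (𝓞 F)ˣ, v ^ 3 ∈ ((unitsE L).map (Herbrand.norm (L ≃ₐ[F] L))).comap
      (Units.map (algebraMap (𝓞 F) L : 𝓞 F →* L)) := by
    intro v
    rw [mem_comap_map_norm_iff]
    refine ⟨Units.map (algebraMap (𝓞 F) (𝓞 L) : 𝓞 F →* 𝓞 L) v, ?_⟩
    rw [Units.coe_map, MonoidHom.coe_coe, RingOfIntegers.coe_eq_algebraMap,
      ← IsScalarTower.algebraMap_apply, IsScalarTower.algebraMap_apply (𝓞 F) F L,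
      Algebra.norm_algebraMap, hdeg, Units.val_pow_eq_pow_val, RingOfIntegers.coe_eq_algebraMap,
      map_pow]
  have hu' : u ∉ ((unitsE L).map (Herbrand.norm (L ≃ₐ[F] L))).comap
      (Units.map (algebraMap (𝓞 F) L : 𝓞 F →* L)) := by
    rw [mem_comap_map_norm_iff]
    rintro ⟨ε, hε⟩
    exact hu ε hε
  have h0 : Herbrand.h0 σ (unitsE L) ⊥ = 3 := by
    rw [h0_unitsE_eq_index hσ]
    exact index_eq_three_of_cube hu' hcube hgen
  -- (4) `#Ĥ⁻¹ = 9` by the unit Herbrand quotient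
  have h1 : Herbrand.h1 σ (unitsE L) ⊥ = 9 := by
    obtain ⟨hmain, -⟩ := MinkowskiUnit.card_mul_h0_unitsE_eq (F := F) (E := L) hσ
    rw [hcard, h0, harch, one_mul] at hmain
    omega
  -- (5) nine cosets of `{σ η / η}` in the norm-one units, pulled back to `𝓞_Lˣ`
  obtain ⟨Z, hZ⟩ : ∃ Z : Subgroup (𝓞 L)ˣ, Z = (Herbrand.z1 (L ≃ₐ[F] L) (unitsE L) ⊥).comap
      (Units.map (algebraMap (𝓞 L) L : 𝓞 L →* L)) := ⟨_, rfl⟩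
  obtain ⟨B, hB⟩ : ∃ B : Subgroup (𝓞 L)ˣ, B = (Herbrand.b1 σ (unitsE L) ⊥).comap
      (Units.map (algebraMap (𝓞 L) L : 𝓞 L →* L)) := ⟨_, rfl⟩
  have hidx : Nat.card (Z ⧸ B.subgroupOf Z) = 9 := by
    rw [← h1, Herbrand.h1_def, ← Subgroup.index_eq_card]
    change B.relIndex Z = _
    rw [hB, Subgroup.relIndex_comap, hZ, Subgroup.map_comap_eq, show (Units.map
        (algebraMap (𝓞 L) L : 𝓞 L →* L)).range = unitsE L from rfl, inf_eq_right.mpr Herbrand.z1_le]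
  have hfin : Nat.card (Z ⧸ B.subgroupOf Z) ≠ 0 := by omega
  obtain ⟨e⟩ : Nonempty ((Z ⧸ B.subgroupOf Z) ≃ Fin 9) :=
    ⟨(Nat.equivFinOfCardPos hfin).trans (finCongr hidx)⟩
  obtain ⟨s, hs⟩ := (QuotientGroup.mk_surjective (s := B.subgroupOf Z)).hasRightInverse
  refine ⟨fun i => ((s (e.symm i) : Z) : (𝓞 L)ˣ), fun i => ?_, fun i j hij η heq => hij ?_⟩
  · -- norm one
    have hmem := hZ.le (s (e.symm i)).2
    rw [Subgroup.mem_comap, Herbrand.mem_z1_bot] at hmem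
    exact (herbrandNorm_eq_one_iff _).mp hmem.2
  · -- distinct classes modulo `σ`-coboundaries
    apply e.symm.injective
    rw [← hs (e.symm i), ← hs (e.symm j), QuotientGroup.eq, Subgroup.mem_subgroupOf,
      Subgroup.coe_mul, Subgroup.coe_inv]
    refine hB.ge ?_
    rw [Subgroup.mem_comap, map_mul, map_inv, Herbrand.b1_bot]
    refine ⟨(Units.map (algebraMap (𝓞 L) L : 𝓞 L →* L) η)⁻¹, (unitsE L).inv_mem ⟨η, rfl⟩, ?_⟩
    -- `(σ • η / η)⁻¹ = εᵢ⁻¹ εⱼ` in `Lˣ`, from `εᵢ η = εⱼ σ(η)` in `L`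
    have hunits : Units.map (algebraMap (𝓞 L) L : 𝓞 L →* L) (s (e.symm i) : (𝓞 L)ˣ) *
          Units.map (algebraMap (𝓞 L) L : 𝓞 L →* L) η =
        Units.map (algebraMap (𝓞 L) L : 𝓞 L →* L) (s (e.symm j) : (𝓞 L)ˣ) *
          (σ • Units.map (algebraMap (𝓞 L) L : 𝓞 L →* L) η) := by
      ext
      rw [Units.val_mul, Units.val_mul, val_smul, val_unitsMap, val_unitsMap, val_unitsMap]
      exact heq
    rw [map_inv, Herbrand.twist_apply, inv_div, div_eq_iff_eq_mul, mul_assoc,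
      eq_inv_mul_iff_mul_eq]
    exact hunits

end Literature.NumberTheory.NumberFields.Honda1971

end Part4

/-!
## Part 5 — port of `Summits/QuantumAdvantage/QuantumAdvantage/Theorems/LinnikCubicClassGroupsPureCubicClassNumberHardHonda25.lean` (2 declarations kept)

# `p ≡ 2`, `q ≡ 5 (mod 9)`: `3 ∤ h(K)` for every cubic `K ∋ ∛(pq)` (Chevalley's ambiguous-class argument assembled)

The inert case of Honda's criterion: `honda25` — Chevalley's ambiguous-class argument for the cyclic cubic
`L = K(ζ₃) / F = ℚ(ζ₃)`, assembled from the parts above and of `PureCubicAmbiguousClassDescent.lean`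
(`fieldSetup`: the Kummer set-up and the totally ramified primes above `p, q`; `ramificationCensus`: no other prime of
`F` ramifies — Dedekind species 2, `pq ≡ 1 (mod 9)`; `zetaNotNorm`: `ζ₃` is not a norm from `L`, local obstruction at
the inert `p`; `unitsNormOne9`: nine norm-one units inequivalent modulo `σ`-coboundaries from the unit Herbrand
quotient; `invariantIdealsPrincipal`: `σ`-invariant ideals are principal; `classNumber_not_dvd`: invariant classes
contain invariant ideals (Hilbert 90), and a `3`-cycle on `Cl(L)` with one fixed point forces `3 ∤ h_L`) and the ascent
`3 ∣ h_K ⟹ 3 ∣ h_L` (`Honda1971.dvd_classNumber_of_dvd_classNumber_of_not_dvd_finrank`, sibling proofs file);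
`honda25_norm_unit` — hypothesis (i) of `classNumber_not_dvd`: an element of `L` whose norm is a unit of `F` has the
norm of a unit (the units of `F` are `±ζ₃ⁱ` and `ζ₃ ∉ N(L^×)`).

## References
* T. Honda, *Pure cubic fields whose class numbers are multiples of three*, J. Number Theory 3
  (1971) 7–12, Theorem. [Honda1971]
* S. Aouissi, D. C. Mayer, M. C. Ismaili, M. Talbi, A. Azizi, *3-rank of ambiguous class groups of
  cubic Kummer extensions*, Period. Math. Hungar. 81 (2020), §2.1 and Thm. 2.3. [AouissiMayerIsmailiTalbiAzizi2020]
* C. Chevalley, *Sur la théorie du corps de classes dans les corps finis et les corps locaux*,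
  J. Fac. Sci. Tokyo 2 (1933) (ambiguous class number formula). [Chevalley1933]
-/

section Part5

open scoped _root_.Pointwise _root_.NumberField

namespace Literature.NumberTheory.NumberFields.Honda1971

open _root_.NumberField

/-! ### The (2,5)-direction of Honda's criterion -/

/-- Norms meeting the units of `F`: if `ζ` is not a norm from the cubic extension `L/F` and every
unit of `F` is `±ζ^i` (with `ζ³ = 1`), then an element of `L` whose norm is a unit of `F` has norm
`±1`, i.e. the norm of the unit `±1` of `L`. [cite: AouissiMayerIsmailiTalbiAzizi2020, Thm. 2.3 item (5) (f = q₁q₂ with q_j ≡ 2,5 (mod 9) ⟹ 3 ∤ h_L)] -/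
theorem honda25_norm_unit
    (F L : Type) [Field F] [NumberField F] [Field L] [NumberField L] [Algebra F L]
    (h3 : Module.finrank F L = 3)
    (ζ : (𝓞 F)ˣ) (hζ3 : ((ζ : 𝓞 F) : F) ^ 3 = 1)
    (hunits : ∀ w : (𝓞 F)ˣ, ∃ i : ℕ, w = ζ ^ i ∨ w = -ζ ^ i)
    (hnn : ∀ x : L, Algebra.norm F x ≠ ((ζ : 𝓞 F) : F)) :
    ∀ x : L, (∃ u : (𝓞 F)ˣ, Algebra.norm F x = ((u : 𝓞 F) : F)) →
      ∃ ε : (𝓞 L)ˣ, Algebra.norm F (((ε : 𝓞 L) : L)) = Algebra.norm F x := by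
  intro x ⟨u, hu⟩
  obtain ⟨i, hi⟩ := hunits u
  set z : F := ((ζ : 𝓞 F) : F) with hz
  have hzpow : ∀ n : ℕ, (((ζ ^ n : (𝓞 F)ˣ) : 𝓞 F) : F) = z ^ n := by
    intro n; simp [hz]
  have hneg : ∀ n : ℕ, (((-ζ ^ n : (𝓞 F)ˣ) : 𝓞 F) : F) = -z ^ n := by
    intro n; simp [hz]
  have hN1 : Algebra.norm F (((((-1 : (𝓞 L)ˣ) : 𝓞 L) : L))) = -1 := by
    have : ((((-1 : (𝓞 L)ˣ) : 𝓞 L) : L)) = algebraMap F L (-1) := by simp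
    rw [this, Algebra.norm_algebraMap, h3]; norm_num
  have key : ∀ (s : F) (n : ℕ), (s = 1 ∨ s = -1) → Algebra.norm F x = s * z ^ n →
      ∃ ε : (𝓞 L)ˣ, Algebra.norm F (((ε : 𝓞 L) : L)) = Algebra.norm F x := by
    intro s n hs hxn
    have hz3 : z ^ 3 = 1 := hζ3
    have hzn : z ^ n = z ^ (n % 3) := by
      conv_lhs => rw [← Nat.div_add_mod n 3, pow_add, pow_mul, hz3, one_pow, one_mul]
    rw [hzn] at hxn
    have hlt : n % 3 < 3 := Nat.mod_lt _ (by norm_num)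
    have hsx : Algebra.norm F ((algebraMap F L s) * x) = z ^ (n % 3) := by
      rw [map_mul, Algebra.norm_algebraMap, h3, hxn]
      rcases hs with rfl | rfl <;> ring
    interval_cases hmod : n % 3
    · rcases hs with rfl | rfl
      · refine ⟨1, ?_⟩
        rw [hxn]; simp
      · refine ⟨-1, ?_⟩
        rw [hN1, hxn]; simp
    · exact absurd (by simpa using hsx) (hnn ((algebraMap F L s) * x))
    · exfalso
      refine hnn (((algebraMap F L s) * x) ^ 2) ?_
      rw [map_pow, hsx, ← pow_mul]
      calc z ^ (2 * 2) = z ^ 3 * z := by ring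
        _ = z := by rw [hz3, one_mul]
  rcases hi with rfl | rfl
  · exact key 1 i (Or.inl rfl) (by rw [hu, hzpow, one_mul])
  · exact key (-1) i (Or.inr rfl) (by rw [hu, hneg]; ring)

/-- **The `(2,5)`-direction of Honda's two-prime criterion** (Honda 1971, Theorem, case (v) /
[AouissiMayerIsmailiTalbiAzizi2020, Thm. 2.3 (5)]): for primes `p ≡ 2`, `q ≡ 5 (mod 9)` and every
cubic number field `K ∋ ∛(pq)`, `3 ∤ h_K`.  Proof (Chevalley's ambiguous classes): in `L = K(ζ₃)`
over `F = ℚ(ζ₃)` exactly the primes above `p` and `q` ramify (totally), `ζ₃` is not a norm from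
`L`, so `#Ĥ⁻¹(σ, 𝓞_Lˣ) = 9`, every `σ`-invariant ideal of `L` is principal, every invariant class
is trivial and `3 ∤ h_L`; but `3 ∣ h_K ⟹ 3 ∣ h_L` since `[L:K] = 2`. [cite: AouissiMayerIsmailiTalbiAzizi2020, Thm. 2.3 item (5)] -/
theorem honda25 (p q : ℕ) (hp : p.Prime) (hq : q.Prime) (hp9 : p % 9 = 2) (hq9 : q % 9 = 5)
    (K : Type) [Field K] [NumberField K] (hK : Module.finrank ℚ K = 3)
    (hα : ∃ α : K, α ^ 3 = ((p * q : ℕ) : K)) : ¬ 3 ∣ classNumber K := by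
  intro h3K
  obtain ⟨L, _, _, _, hKL, hL6, F, hgal, hFL, ⟨σ, hσ⟩, hPID, hcplx, hθ, ζ, hζ3, hζ1, hunits,
    P₁, P₂, hP₁, hP₂, hP12, hspan₁, hspan₂, he₁, h3not, h9⟩ :=
    fieldSetup p q hp hq hp9 hq9 K hK hα
  haveI := hgal
  have h3L : 3 ∣ classNumber L :=
    Literature.NumberTheory.NumberFields.Honda1971.dvd_classNumber_of_dvd_classNumber_of_not_dvd_finrank
      (K := K) (L := L) Nat.prime_three h3K (by rw [hKL]; norm_num)
  have hp3 : p ≠ 3 := by omega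
  have hq3 : q ≠ 3 := by omega
  have hpq : p ≠ q := by omega
  have hpq9 : (p * q) % 9 = 1 := by rw [Nat.mul_mod, hp9, hq9]
  have hζF : ∃ z : F, z ^ 3 = 1 ∧ z ≠ 1 := ⟨((ζ : 𝓞 F) : F), hζ3, hζ1⟩
  have hcensus : ∀ (Q : Ideal (𝓞 L)), Q.IsMaximal →
      Q.ramificationIdx (𝓞 F) ≠ 1 → Q = P₁ ∨ Q = P₂ := by
    intro Q hQ hram
    have key : ∀ {r : ℕ} {P : Ideal (𝓞 L)}, P.IsMaximal →
        Ideal.span {(r : 𝓞 L)} = P ^ 3 → (r : 𝓞 L) ∈ Q → Q = P := by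
      intro r P hP hspan hr
      have hle : P ^ 3 ≤ Q := by
        rw [← hspan, Ideal.span_singleton_le_iff_mem]
        simpa using hr
      have hPQ : P ≤ Q := (Ideal.IsPrime.pow_le_iff (I := P) (hP := hQ.isPrime) (by norm_num)).mp hle
      exact (hP.eq_of_le hQ.ne_top hPQ).symm
    rcases ramificationCensus p q hp hq hp3 hq3 hpq hpq9 L F hL6 hFL hζF hθ Q hQ hram with h | h
    · exact Or.inl (key hP₁ hspan₁ h)
    · exact Or.inr (key hP₂ hspan₂ h)
  have ht₁ : ∃ t : 𝓞 F, Ideal.span {algebraMap (𝓞 F) (𝓞 L) t} = P₁ ^ 3 := ⟨p, by simpa using hspan₁⟩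
  have ht₂ : ∃ t : 𝓞 F, Ideal.span {algebraMap (𝓞 F) (𝓞 L) t} = P₂ ^ 3 := ⟨q, by simpa using hspan₂⟩
  have hnn : ∀ x : L, Algebra.norm F x ≠ ((ζ : 𝓞 F) : F) :=
    zetaNotNorm F L hFL (ζ : 𝓞 F) hζ3 hζ1 P₁ hP₁ he₁ ht₁ h3not h9
  have hu1 : ∀ ε : (𝓞 L)ˣ, Algebra.norm F (((ε : 𝓞 L) : L)) ≠ ((ζ : 𝓞 F) : F) := fun ε => hnn _
  have hu2 : ∀ w : (𝓞 F)ˣ, ∃ i : ℕ, ∃ v : (𝓞 F)ˣ, w = ζ ^ i * v ^ 3 := by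
    intro w
    obtain ⟨i, hi | hi⟩ := hunits w
    · exact ⟨i, 1, by rw [hi]; simp⟩
    · exact ⟨i, -1, by rw [hi]; norm_num⟩
  have hnine := unitsNormOne9 F L σ hσ hFL hcplx ζ hu1 hu2
  have hprinc : ∀ I : Ideal (𝓞 L), I ≠ ⊥ → σ • I = I → Submodule.IsPrincipal I :=
    invariantIdealsPrincipal F L σ hσ hFL hPID P₁ P₂ hP₁ hP₂ hP12 ht₁ ht₂ hcensus hnine
  have hH3 := honda25_norm_unit F L hFL ζ hζ3 hunits hnn
  exact classNumber_not_dvd F L σ hσ hFL hH3 hprinc h3L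

end Literature.NumberTheory.NumberFields.Honda1971

end Part5

/-!
## Part 6 — port of `Summits/QuantumAdvantage/QuantumAdvantage/Theorems/LinnikCubicClassGroupsPureCubicClassNumberHardHondaTwoInertSetup.lean` (2 declarations kept)

# Field set-up for `K ∋ ∛(pq)` with two primes `p, q ≡ 2 (mod 3)` (any residues mod `9`)

Two declarations of the source module (the others concern the conductors `3pq` / `9pq` and are not needed here):
* `eq_pow_of_pow_three_eq` — `I³ = P^{3n}` forces `I = Pⁿ` (Dedekind domains);
* `fieldSetup_twoPrimes` — the Galois/unit/ramification data of `L/F/ℚ` for `K ∋ ∛(pq)`, `L = K(ζ₃) ⊃ F = ℚ(ζ₃)`: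
  `F` is a PID with units `±ζ₃ⁱ`, `Gal(L/F)` is cyclic of order `3`, and the primes `P₁ ∋ p`, `P₂ ∋ q` of `L` satisfy
  `p𝓞_L = P₁³`, `q𝓞_L = P₂³`, `e(Pᵢ | F) = 3`.

## References
* T. Honda, *Pure cubic fields whose class numbers are multiples of three*, J. Number Theory 3
  (1971) 7–12, Theorem. [Honda1971]
* S. Aouissi, D. C. Mayer, M. C. Ismaili, M. Talbi, A. Azizi, Period. Math. Hungar. 81 (2020),
  §2.1–2.2, Thm. 2.3. [AouissiMayerIsmailiTalbiAzizi2020]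
-/

section Part6

open _root_.NumberField _root_.Polynomial

open scoped _root_.Pointwise _root_.NumberField _root_.IntermediateField

namespace Literature.NumberTheory.NumberFields.Honda1971

open Literature.NumberTheory.NumberFields _root_.IsDedekindDomain

/-! ### Cube roots of ideals -/

/-- In a Dedekind domain, `I³ = P^{3n}` for a maximal `P` forces `I = P^n`. [cite: AouissiMayerIsmailiTalbiAzizi2020, §2.1–2.2 (field set-up k = L(ζ₃)/k₀ for d = pq with p, q ≡ 2 (mod 3); totally ramified p, q)] -/
theorem eq_pow_of_pow_three_eq {R : Type*} [CommRing R] [IsDedekindDomain R] {I P : Ideal R}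
    (hP : P.IsMaximal) (hP0 : P ≠ ⊥) {n : ℕ} (h : I ^ 3 = P ^ (3 * n)) : I = P ^ n := by
  have hprime : Prime P := Ideal.prime_of_isPrime hP0 hP.isPrime
  have hdvd : I ∣ P ^ (3 * n) := ⟨I ^ 2, by rw [← h]; ring⟩
  obtain ⟨i, -, hi⟩ := (dvd_prime_pow hprime _).mp hdvd
  have hIeq : I = P ^ i := associated_iff_eq.mp hi
  rw [hIeq, ← pow_mul] at h
  have hinj := (Ideal.pow_right_strictAnti P hP0 hP.ne_top).injective h
  rw [hIeq]
  congr 1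
  omega

/-! ### The prime of `K` above `3` (Dedekind's first species) -/

/-- **Field set-up for `K ∋ ∛(pq)`, `p, q ≡ 2 (mod 3)` distinct primes** (any residues mod `9`):
`L = K(ζ₃)` (`[L:K] = 2`, `[L:ℚ] = 6`, Galois over `ℚ`), `F = ℚ(ζ₃)` (`[F:ℚ] = 2`, `L/F` cyclic
cubic, `𝓞_F` a PID, `F` totally complex, units `±ζ₃^i`, `ζ₃² + ζ₃ + 1 = 0` in `𝓞_F`), `θ = α`
with `[ℚ(θ):ℚ] = 3`, and the totally ramified primes `P₁ ∋ p`, `P₂ ∋ q` (`p𝓞_L = P₁³`,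
`q𝓞_L = P₂³`, `e = 3`). [cite: AouissiMayerIsmailiTalbiAzizi2020, §2.1–2.2 (field set-up k = L(ζ₃)/k₀ for d = pq with p, q ≡ 2 (mod 3); totally ramified p, q)] -/
theorem fieldSetup_twoPrimes {p q : ℕ} (hp : p.Prime) (hq : q.Prime) (hpq : p ≠ q)
    (hp3 : p % 3 = 2) (hq3 : q % 3 = 2) (K : Type*) [Field K]
    [NumberField K] (hK : Module.finrank ℚ K = 3) {α : K} (hα : α ^ 3 = ((p * q : ℕ) : K))
    (L : Type*) [Field L] [NumberField L] [Algebra K L] [IsCyclotomicExtension {3} K L] :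
    Module.finrank K L = 2 ∧ Module.finrank ℚ L = 6 ∧ IsGalois ℚ L ∧
      ∃ F : IntermediateField ℚ L,
        IsGalois F L ∧ Module.finrank F L = 3 ∧ Module.finrank ℚ F = 2 ∧
        (∃ σ : L ≃ₐ[F] L, ∀ τ : L ≃ₐ[F] L, τ ∈ Subgroup.zpowers σ) ∧
        IsPrincipalIdealRing (𝓞 F) ∧
        (∀ v : NumberField.InfinitePlace F, v.IsComplex) ∧
        (∃ θ : L, θ ^ 3 = ((p * q : ℕ) : L) ∧ Module.finrank ℚ ℚ⟮θ⟯ = 3) ∧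
        ∃ ζ : (𝓞 F)ˣ, ((ζ : 𝓞 F) : F) ^ 3 = 1 ∧ ((ζ : 𝓞 F) : F) ≠ 1 ∧
          (ζ : 𝓞 F) ^ 2 + (ζ : 𝓞 F) + 1 = 0 ∧
          (∀ w : (𝓞 F)ˣ, ∃ i : ℕ, w = ζ ^ i ∨ w = -ζ ^ i) ∧
          ∃ P₁ P₂ : Ideal (𝓞 L), P₁.IsMaximal ∧ P₂.IsMaximal ∧ P₁ ≠ P₂ ∧
            (p : 𝓞 L) ∈ P₁ ∧ (q : 𝓞 L) ∈ P₂ ∧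
            Ideal.span {(p : 𝓞 L)} = P₁ ^ 3 ∧ Ideal.span {(q : 𝓞 L)} = P₂ ^ 3 ∧
            P₁.ramificationIdx (𝓞 F) = 3 ∧ P₂.ramificationIdx (𝓞 F) = 3 := by
  have hKL : Module.finrank K L = 2 := by
    rw [IsCyclotomicExtension.finrank L (irreducible_cyclotomic_three_of_finrank_eq_three hK),
      Nat.totient_prime Nat.prime_three]
  have hL6 : Module.finrank ℚ L = 6 := by
    rw [← Module.finrank_mul_finrank ℚ K L, hK, hKL]
  obtain ⟨ζ, hζ⟩ : ∃ ζ : L, IsPrimitiveRoot ζ 3 := ⟨_, IsCyclotomicExtension.zeta_spec 3 K L⟩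
  haveI hGal : IsGalois ℚ L := isGalois_rat_of_isCyclotomicExtension_three hp hq hpq hK hα L
  haveI hF : IsCyclotomicExtension {3} ℚ ℚ⟮ζ⟯ :=
    hζ.intermediateField_adjoin_isCyclotomicExtension ℚ
  have hF2 : Module.finrank ℚ ℚ⟮ζ⟯ = 2 := by
    rw [IsCyclotomicExtension.finrank (n := 3) ℚ⟮ζ⟯ (cyclotomic.irreducible_rat (by norm_num)),
      Nat.totient_prime Nat.prime_three]
  have hFL : Module.finrank ℚ⟮ζ⟯ L = 3 := by
    have h := Module.finrank_mul_finrank ℚ ℚ⟮ζ⟯ L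
    rw [hF2, hL6] at h
    omega
  have hθ : ∃ θ : L, θ ^ 3 = ((p * q : ℕ) : L) ∧ Module.finrank ℚ ℚ⟮θ⟯ = 3 := by
    refine ⟨algebraMap K L α, by rw [← map_pow, hα, map_natCast], ?_⟩
    have hθ3 : (algebraMap K L α) ^ 3 = ((p * q : ℕ) : L) := by rw [← map_pow, hα, map_natCast]
    have hint : IsIntegral ℚ (algebraMap K L α) := .of_finite ℚ _
    rw [IntermediateField.adjoin.finrank hint, Honda1971.minpoly_eq hp hq hpq hθ3,
      natDegree_X_pow_sub_C]
  refine ⟨hKL, hL6, hGal, ℚ⟮ζ⟯, inferInstance, hFL, hF2, ?_, IsCyclotomicExtension.Rat.three_pid ℚ⟮ζ⟯,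
    (IsCyclotomicExtension.Rat.isTotallyComplex ℚ⟮ζ⟯ (n := 3) (by norm_num)).isComplex, hθ, ?_⟩
  · haveI : Fact (Nat.Prime 3) := ⟨Nat.prime_three⟩
    haveI : IsCyclic (L ≃ₐ[ℚ⟮ζ⟯] L) :=
      isCyclic_of_prime_card (p := 3) (by rw [IsGalois.card_aut_eq_finrank, hFL])
    exact IsCyclic.exists_generator
  have hζF : IsPrimitiveRoot (⟨ζ, IntermediateField.mem_adjoin_simple_self ℚ ζ⟩ : ℚ⟮ζ⟯) 3 :=
    IsPrimitiveRoot.coe_submonoidClass_iff.mp hζ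
  obtain ⟨η, hη, hunits⟩ := exists_units_eq_pow_or_neg_pow hζF
  refine ⟨η, ?_, ?_, ?_, hunits, ?_⟩
  · rw [hη]; exact hζF.pow_eq_one
  · rw [hη]; exact hζF.ne_one (by norm_num)
  · have h3 := hζF.pow_eq_one
    have h1 := hζF.ne_one (by norm_num)
    rw [← hη] at h3 h1
    have hfac : (((η : 𝓞 ℚ⟮ζ⟯) : ℚ⟮ζ⟯) - 1) *
        (((η : 𝓞 ℚ⟮ζ⟯) : ℚ⟮ζ⟯) ^ 2 + ((η : 𝓞 ℚ⟮ζ⟯) : ℚ⟮ζ⟯) + 1) = 0 := by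
      linear_combination h3
    have hF' : ((η : 𝓞 ℚ⟮ζ⟯) : ℚ⟮ζ⟯) ^ 2 + ((η : 𝓞 ℚ⟮ζ⟯) : ℚ⟮ζ⟯) + 1 = 0 := by
      rcases mul_eq_zero.mp hfac with h | h
      · exact absurd (sub_eq_zero.mp h) h1
      · exact h
    apply RingOfIntegers.coe_injective
    push_cast
    exact hF'
  obtain ⟨P₁, hP₁, hpP₁, hspan₁, he₁, -, -⟩ :=
    exists_prime_pow_three_eq_span ℚ⟮ζ⟯ hL6 hp hq hpq hp3 hK hα
  have hα' : α ^ 3 = ((q * p : ℕ) : K) := by rwa [Nat.mul_comm]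
  obtain ⟨P₂, hP₂, hqP₂, hspan₂, he₂, -, -⟩ :=
    exists_prime_pow_three_eq_span ℚ⟮ζ⟯ hL6 hq hp hpq.symm hq3 hK hα'
  refine ⟨P₁, P₂, hP₁, hP₂, ?_, hpP₁, hqP₂, hspan₁, hspan₂, he₁, he₂⟩
  rintro rfl
  have hcop : IsCoprime (p : 𝓞 L) (q : 𝓞 L) := by
    have h' : IsCoprime (p : ℤ) (q : ℤ) :=
      Nat.isCoprime_iff_coprime.mpr ((Nat.coprime_primes hp hq).mpr hpq)
    simpa using h'.map (Int.castRingHom (𝓞 L))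
  obtain ⟨a, b, hab⟩ := hcop
  exact hP₁.ne_top ((Ideal.eq_top_iff_one _).mpr
    (hab ▸ P₁.add_mem (P₁.mul_mem_left a hpP₁) (P₁.mul_mem_left b hqP₂)))

end Literature.NumberTheory.NumberFields.Honda1971

end Part6

/-!
## Part 7 — port of `Summits/QuantumAdvantage/QuantumAdvantage/Theorems/LinnikCubicClassGroupsPureCubicClassNumberHardHonda88.lean` (1 declarations kept)

# Honda's criterion, case `p ≡ q ≡ 8 (mod 9)`: `3 ∣ h(K)` for every cubic `K ∋ ∛(pq)`

`three_dvd_classNumber_of_primes_mod_nine_eight` — the last case of the two-prime criterion: `L = K(ζ₃)` has the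
unramified cyclic cubic extension `L(∛p)` (`three_dvd_classNumber_of_cubeRoot_unramified`), so `3 ∣ h(L)`, and the
Hasse-free descent `three_dvd_classNumber_descent` (`PureCubicAmbiguousClassDescent.lean`) gives `3 ∣ h(K)`.
The assembly of the named fact follows in the last Part.

## References
* T. Honda, *Pure cubic fields whose class numbers are multiples of three*, J. Number Theory 3
  (1971) 7–12, Theorem. [Honda1971]
* S. Aouissi, D. C. Mayer, M. C. Ismaili, M. Talbi, A. Azizi, *3-rank of ambiguous class groups of
  cubic Kummer extensions*, Period. Math. Hungar. 81 (2020), Thm. 2.3. [AouissiMayerIsmailiTalbiAzizi2020]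
-/

section Part7

open _root_.NumberField _root_.Polynomial _root_.IsDedekindDomain

open scoped _root_.Pointwise _root_.NumberField nonZeroDivisors _root_.IntermediateField

namespace Literature.NumberTheory.NumberFields.Honda1971

open Literature.NumberTheory.NumberFields

/-! ### Honda's criterion, case `p ≡ q ≡ 8 (mod 9)` -/

/-- **Honda 1971, the case `m = pq` with `p ≡ q ≡ 8 (mod 9)`: `3 ∣ h(K)` for every cubic number
field `K ∋ ∛(pq)`** — the last case of the two-prime criterion, proved WITHOUT Hasse's norm
theorem and without the Brauer class number relation: `L = K(ζ₃)` has the unramified cyclic cubic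
extension `L(∛p)` (`three_dvd_classNumber_of_cubeRoot_unramified`), so `3 ∣ h(L)`, and the
descent `three_dvd_classNumber_descent` (`τστ = σ²`, `N_{L/K}` on ideals, Chevalley's step per
class) gives `3 ∣ h(K)`. [cite: Honda1971, Theorem] [cite: AouissiMayerIsmailiTalbiAzizi2020, Thm. 2.3] -/
theorem three_dvd_classNumber_of_primes_mod_nine_eight (p q : ℕ) (hp : p.Prime) (hq : q.Prime)
    (hpq : p ≠ q) (hp9 : p % 9 = 8) (hq9 : q % 9 = 8)
    (K : Type) [Field K] [NumberField K] (hK : Module.finrank ℚ K = 3)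
    (hα : ∃ α : K, α ^ 3 = ((p * q : ℕ) : K)) : 3 ∣ classNumber K := by
  classical
  obtain ⟨α, hα⟩ := hα
  have hp3 : p % 3 = 2 := by omega
  have hq3 : q % 3 = 2 := by omega
  have hq3' : q ≠ 3 := by omega
  have hp3' : p ≠ 3 := by omega
  have h91 : (p * q) % 9 = 1 := by
    rw [Nat.mul_mod, hp9, hq9]
  let L := CyclotomicField 3 K
  obtain ⟨hKL, hL6, hGal, F, hgal, hFL, hF2, ⟨σ, hσ⟩, hPID, -, ⟨θ, hθ, hθdeg⟩, ζ, hζ3, hζ1, hζeq,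
    hunits, P₁, P₂, hP₁, hP₂, h12, hpP₁, hqP₂, hspan₁, hspan₂, he₁, he₂⟩ :=
    fieldSetup_twoPrimes hp hq hpq hp3 hq3 K hK hα L
  haveI := hgal
  haveI := hGal
  haveI := hP₁
  haveI := hP₂
  haveI : IsGalois K L := IsCyclotomicExtension.isGalois {3} K L
  -- `3 ∣ h(L)`
  have hζL : (((ζ : 𝓞 F) : F) : L) ^ 2 + (((ζ : 𝓞 F) : F) : L) + 1 = 0 := by
    have h := congrArg (fun w : 𝓞 F => ((w : F) : L)) hζeq
    simpa using h
  have hirr : ∀ b : L, b ^ 3 ≠ (p : L) :=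
    pow_three_ne_natCast_of_ramified F hF2 hFL hp hq hpq hq3' hqP₂ he₂
  have h3L : 3 ∣ classNumber L :=
    three_dvd_classNumber_of_cubeRoot_unramified L hζL hp hq hpq hp9 hθ hirr
  -- the data of the descent
  set αL : L := algebraMap K L α with hαLdef
  have hαL3 : αL ^ 3 = ((p * q : ℕ) : L) := by
    rw [hαLdef, ← map_pow, hα, map_natCast]
  have hθσ : σ αL ≠ αL := by
    intro hfix
    -- `αL ∈ F`, but `[ℚ(αL) : ℚ] = 3 > 2 = [F : ℚ]`
    obtain ⟨f, hf⟩ : ∃ f : F, algebraMap F L f = αL := by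
      refine (IsGalois.mem_range_algebraMap_iff_fixed (F := F) αL).mpr fun g => ?_
      rcases algEquiv_eq_of_forall_mem_zpowers F hσ hFL g with rfl | rfl | rfl
      · rfl
      · exact hfix
      · rw [AlgEquiv.mul_apply, hfix, hfix]
    have hmin : minpoly ℚ αL = X ^ 3 - C ((p * q : ℕ) : ℚ) := Honda1971.minpoly_eq hp hq hpq hαL3
    have hmin' : minpoly ℚ f = minpoly ℚ αL := by
      rw [← hf]
      exact (minpoly.algebraMap_eq (algebraMap F L).injective f).symm
    have hle : (minpoly ℚ f).natDegree ≤ Module.finrank ℚ F := minpoly.natDegree_le f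
    rw [hmin', hmin, natDegree_X_pow_sub_C, hF2] at hle
    omega
  have ht₁ : Ideal.span {algebraMap (𝓞 F) (𝓞 L) (p : 𝓞 F)} = P₁ ^ 3 := by
    rw [map_natCast, hspan₁]
  have ht₂ : Ideal.span {algebraMap (𝓞 F) (𝓞 L) (q : 𝓞 F)} = P₂ ^ 3 := by
    rw [map_natCast, hspan₂]
  -- the ramified primes of `L/F` are `P₁`, `P₂`
  have huniq : ∀ {r : ℕ} {P Q : Ideal (𝓞 L)}, P.IsMaximal → Q.IsMaximal →
      Ideal.span {(r : 𝓞 L)} = P ^ 3 → (r : 𝓞 L) ∈ Q → Q = P := by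
    intro r P Q hP hQ hspan hrQ
    have hle : P ^ 3 ≤ Q := by
      rw [← hspan, Ideal.span_singleton_le_iff_mem]
      exact hrQ
    exact (hP.eq_of_le hQ.ne_top (hQ.isPrime.le_of_pow_le hle)).symm
  have hram : ∀ Q : Ideal (𝓞 L), Q.IsMaximal → Q.ramificationIdx (𝓞 F) ≠ 1 → Q = P₁ ∨ Q = P₂ := by
    intro Q hQ hne
    rcases ramificationCensus p q hp hq hp3' hq3' hpq h91 L F hL6 hFL
        ⟨((ζ : 𝓞 F) : F), hζ3, hζ1⟩ ⟨θ, hθ⟩ Q hQ hne with h | h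
    · exact Or.inl (huniq hP₁ hQ hspan₁ h)
    · exact Or.inr (huniq hP₂ hQ hspan₂ h)
  -- the ideals `𝔭ᵢ = (pᵢ, ∛(pq))` of `K`
  obtain ⟨θK, hθK⟩ := Honda1971.exists_ringOfIntegers_coe_eq_of_pow_three
    (m := p * q) (K := K) (by exact_mod_cast hα)
  have hθK3 : θK ^ 3 = (p : 𝓞 K) * (q : 𝓞 K) := by
    apply RingOfIntegers.coe_injective
    have h := hα
    rw [← hθK] at h
    push_cast at h ⊢
    exact_mod_cast h
  have hbez : ∀ {r s : ℕ}, r.Prime → s.Prime → r ≠ s →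
      ∃ a b : 𝓞 K, a * (r : 𝓞 K) ^ 2 + b * (s : 𝓞 K) = 1 := by
    intro r s hr hs hrs
    have hcop : IsCoprime ((r : ℤ) ^ 2) (s : ℤ) :=
      (Nat.isCoprime_iff_coprime.mpr ((Nat.coprime_primes hr hs).mpr hrs)).pow_left
    obtain ⟨a, b, hab⟩ := hcop
    exact ⟨a, b, by exact_mod_cast hab⟩
  obtain ⟨a₁, b₁, hab₁⟩ := hbez hp hq hpq
  obtain ⟨a₂, b₂, hab₂⟩ := hbez hq hp hpq.symm
  set 𝔭₁ : Ideal (𝓞 K) := Ideal.span {(p : 𝓞 K), θK} with h𝔭₁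
  set 𝔭₂ : Ideal (𝓞 K) := Ideal.span {(q : 𝓞 K), θK} with h𝔭₂
  have h𝔭₁3 : 𝔭₁ ^ 3 = Ideal.span {(p : 𝓞 K)} :=
    Honda1971.span_pair_pow_three_eq_span hθK3 hab₁
  have h𝔭₂3 : 𝔭₂ ^ 3 = Ideal.span {(q : 𝓞 K)} :=
    Honda1971.span_pair_pow_three_eq_span (by rw [hθK3, mul_comm]) hab₂
  have hmap₁ : 𝔭₁.map (algebraMap (𝓞 K) (𝓞 L)) = P₁ := by
    refine eq_pow_of_pow_three_eq hP₁ (Ideal.IsMaximal.ne_bot_of_isIntegral_int P₁) (n := 1) ?_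
      |>.trans (pow_one _)
    rw [← Ideal.map_pow, h𝔭₁3, Ideal.map_span, Set.image_singleton, map_natCast, hspan₁, mul_one]
  have hmap₂ : 𝔭₂.map (algebraMap (𝓞 K) (𝓞 L)) = P₂ := by
    refine eq_pow_of_pow_three_eq hP₂ (Ideal.IsMaximal.ne_bot_of_isIntegral_int P₂) (n := 1) ?_
      |>.trans (pow_one _)
    rw [← Ideal.map_pow, h𝔭₂3, Ideal.map_span, Set.image_singleton, map_natCast, hspan₂, mul_one]
  have hpr₁ : (𝔭₁ ^ 3).IsPrincipal := ⟨⟨(p : 𝓞 K), by rw [h𝔭₁3, Ideal.submodule_span_eq]⟩⟩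
  have hpr₂ : (𝔭₂ ^ 3).IsPrincipal := ⟨⟨(q : 𝓞 K), by rw [h𝔭₂3, Ideal.submodule_span_eq]⟩⟩
  have hm : p * q ≠ 0 := Nat.mul_ne_zero hp.ne_zero hq.ne_zero
  exact three_dvd_classNumber_descent K hK L hKL F hFL hF2 σ hσ hPID ζ hζeq hunits hm hα hθσ
    hP₁ hP₂ ht₁ ht₂ hram hmap₁ hpr₁ hmap₂ hpr₂ h3L

end Literature.NumberTheory.NumberFields.Honda1971

end Part7

/-! ## Part 8 — the EXACT discharge `Honda1971_three_dvd_classNumber_twoPrimes_holds` -/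

namespace Literature.NumberTheory.NumberFields

/-- **Honda's two-prime criterion holds** — the Literature named fact `Honda1971_three_dvd_classNumber_twoPrimes`
(`PureCubicClassNumberModThree.lean`; [AouissiMayerIsmailiTalbiAzizi2020, Thm. 2.3 item (5) with eq. (2.1)], originally
Honda 1971, Theorem): for distinct primes `p, q` with `pq ≡ ±1 (mod 9)` and every cubic number field `K ∋ ∛(pq)`,
`3 ∣ h(K) ⟺ ¬(p ≡ 2,5 ∧ q ≡ 2,5 (mod 9))`.  Assembled from `Honda1971.honda25` (`p ≡ 2`, `q ≡ 5`: `3 ∤ h`), the genus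
case `Honda1971.three_dvd_classNumber_of_mod_three_eq_one` (`p ≡ 1` or `q ≡ 1 (mod 3)`, sibling proofs file) and
`Honda1971.three_dvd_classNumber_of_primes_mod_nine_eight` (`p ≡ q ≡ 8 (mod 9)`).  EXACT discharge, Literature-side twin
of `Summit.QuantumAdvantage.QuantumAdvantage.Theorems.LinnikCubicClassGroups.Honda1971_three_dvd_classNumber_twoPrimes_holds`
(same proof). [cite: AouissiMayerIsmailiTalbiAzizi2020, Thm. 2.3 item (5) with eq. (2.1)] [cite: Honda1971, Theorem] -/
theorem Honda1971_three_dvd_classNumber_twoPrimes_holds :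
    Honda1971_three_dvd_classNumber_twoPrimes := by
  intro p q hp hq hpq h9 K _ _ hK hα
  obtain ⟨α, hα⟩ := hα
  constructor
  · rintro h3 ⟨hp25, hq25⟩
    have hmod : (p * q) % 9 = (p % 9) * (q % 9) % 9 := Nat.mul_mod p q 9
    rcases hp25 with hp9 | hp9 <;> rcases hq25 with hq9 | hq9 <;> rw [hp9, hq9] at hmod <;>
      norm_num at hmod
    · omega
    · exact Honda1971.honda25 p q hp hq hp9 hq9 K hK ⟨α, hα⟩ h3
    · exact Honda1971.honda25 q p hq hp hq9 hp9 K hK ⟨α, by rw [hα, mul_comm]⟩ h3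
    · omega
  · intro hnot
    rcases (Honda1971.not_twoFive_iff h9).mp hnot with h1 | h1 | ⟨hp8, hq8⟩
    · exact Honda1971.three_dvd_classNumber_of_mod_three_eq_one hp hq hpq (Or.inl h1) K hK hα
    · exact Honda1971.three_dvd_classNumber_of_mod_three_eq_one hp hq hpq (Or.inr h1) K hK hα
    · exact Honda1971.three_dvd_classNumber_of_primes_mod_nine_eight p q hp hq hpq hp8 hq8 K hK
        ⟨α, hα⟩

end Literature.NumberTheory.NumberFields

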